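import Mathlib.MeasureTheory.Function.Jacobian
import Mathlib.MeasureTheory.Constructions.HaarToSphere
import Literature.Geometry.Riemannian.BonnetMyers
import Literature.Geometry.Riemannian.InjectivityDomainOpen
import Literature.Geometry.Riemannian.ExpMapThm1034
import Literature.Geometry.Riemannian.HopfRinowHeineBorel
import Literature.Geometry.Riemannian.RicciNonnegInfiniteVolume
import Literature.Geometry.Lorentzian.EndVolume
import Literature.Geometry.Lorentzian.VolumeChartIntegral
import Literature.Geometry.Lorentzian.VolumePositivity
import Literature.Geometry.Lorentzian.VolumeProofs
import Literature.Geometry.Lorentzian.CoordCurvatureNormSq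
import HarnessLib

/-!
# Complete noncompact manifolds with `Ric ≥ 0` have infinite volume (Calabi, Yau 1976) — proof

Discharge `ricciNonneg_infiniteVolume_holds` of the named fact `ricciNonneg_infiniteVolume`
(`RicciNonnegInfiniteVolume.lean`): a connected noncompact smooth `n`-manifold with a complete
`C^∞` Riemannian metric of nonnegative Ricci curvature has `Vol(M) = ∞` (S.-T. Yau, Indiana Univ.
Math. J. 25 (1976) 659–670; E. Calabi 1975). We follow the proof printed in Chow et al., *The
Ricci flow: techniques and applications, Part I* (AMS 2007), proof of Thm. 2.92, (2.118) and
App. A, Cor. A.4/A.6 ("Yau's argument"): if `Vol(M) = V < ∞`, fix `p` and, `M` being connected,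
complete and noncompact, pick for every `R ≥ 2` a point `q` with `d(p, q) = R`; then
`B(p, 1) ⊆ B(q, R + 1) ∖ B̄(q, R - 1)` and the relative (annular) Bishop–Gromov inequality for
`Ric ≥ 0` gives `Vol B(p, 1) ≤ (((R+1)^n - (R-1)^n)/(R-1)^n) Vol B(q, R-1) ≤ C(R) V` with
`C(R) → 0`, contradicting `Vol B(p, 1) > 0`.

The tree had every ingredient of Bishop–Gromov except the manifold layer of geodesic polar
coordinates, which is supplied here (no definitions and no named facts are introduced):

* Part A (`Literature.Geometry.Lorentzian`, any Riemannian manifold modelled on `ℝᵐ`): the area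
  formula `vol_h(Φ A) = ∫_A √(det h(dΦ eᵢ, dΦ eⱼ))` for a map `Φ : ℝᵐ → N` differentiable and
  injective on an open `W ⊇ A` (`riemannianMeasure_image_eq_lintegral_of_injOn`; Federer 1969,
  §3.2.3, §3.2.46; the chart formula `riemannianMeasure_eq_integral_sqrt_det_holds` transported by
  Mathlib's Euclidean change of variables), null images of Lebesgue-null sets
  (`riemannianMeasure_image_eq_zero_of_volume_eq_zero`) and continuity of the density
  (`continuous_sqrt_det_inner_mfderiv`).
* Part B: the differential of `exp_p` along a ray in a parallel orthonormal frame is given by the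
  normal Jacobi tensor (`normalJacobiTensor_frame_expMap`, from the tree's
  `normalJacobiTensor_frame` and Gauss lemma material).
* Part C: Gram-determinant algebra (`det_gram_eq_of_orthonormal`, `det_eq_of_option_block`).
* Part D: **Bishop's monotonicity** — for `Ric ≥ 0` the Jacobian `𝒥(rθ) = det 𝒜(r)/r^{n-1}` of
  `exp_q ∘ L` (`L` a linear isometry `ℝⁿ ≅ T_qM`) is non-increasing in `r` before the first
  conjugate point (`antitoneOn_jacobian_expMap_ray`; Chavel 2006, Thm. III.4.3, from the tree's
  matrix Riccati comparison `jacobi_det_div_pow_antitoneOn`).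
* Part E: polar coordinates on `ℝⁿ` (Mathlib's `measurePreserving_homeomorphUnitSphereProd`),
  Lebesgue-null sets meeting each ray at most once, and Gromov's one-variable inequality
  `∫_{[a,b)} φ r^k ≤ ((b^{k+1}-a^{k+1})/a^{k+1}) ∫_{(0,a)} φ r^k` for non-increasing `φ`, giving the
  shell-versus-ball inequality `setLIntegral_shell_le_mul_setLIntegral_ball` for radially
  non-increasing densities.
* Part F: `ID(q)` is open on complete manifolds (the tree's compact-case proof of Lee 2018,
  Thm. 10.34 (a), verbatim with completeness as hypothesis), Hopf–Rinow polar representation of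
  points, the linear isometry `L`, and the assembly `riemannianMeasure_univ_eq_top_of_ricci_nonneg`:
  with `W = L⁻¹ ID(q)` (open, star-shaped, `exp_q ∘ L` injective on it) and the Lebesgue-null set
  `N` of "last points" of `W` on rays, every point at distance in `(R-1, R+1)` from `q` is the
  image of a point of `(W ∩ shell) ∪ N`, so the area formula, Part D and Part E give the displayed
  inequality; dimension `0` is vacuous (`false_of_chartedSpace_euclideanSpace_fin_zero`).

Yau's own proof (via his function-theoretic Liouville-type results) is not followed: the held
scan of [Yau1976] has no text layer, and the textbook route through volume comparison is the one
quoted by the fact's docstring ([ChowEtAl2007RicciFlowI], App. A, Cor. A.6).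

## References

* S.-T. Yau, *Some function-theoretic properties of complete Riemannian manifold and their
  applications to geometry*, Indiana Univ. Math. J. 25 (1976) 659–670. [Yau1976]
* B. Chow, S.-C. Chu, D. Glickenstein, C. Guenther, J. Isenberg, T. Ivey, D. Knopf, P. Lu, F. Luo,
  L. Ni, *The Ricci flow: techniques and applications, Part I*, Math. Surveys Monogr. 135, AMS
  2007, proof of Thm. 2.92 ((2.118)); App. A, Cor. A.4, Cor. A.6. [ChowEtAl2007RicciFlowI]
* I. Chavel, *Riemannian Geometry: A Modern Introduction*, 2nd ed., CUP 2006, §III.3 ((III.3.5)),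
  §III.4 (Lemma III.4.1, Thm. III.4.3, (III.4.12)–(III.4.13)). [Chavel2006]
* H. Federer, *Geometric Measure Theory*, Springer 1969, §3.2.3, §3.2.46. [Federer1969]
* J. M. Lee, *Introduction to Riemannian Manifolds*, 2nd ed., Springer 2018, Cor. 6.21,
  Prop. 10.32, Thm. 10.34, p. 310. [LeeRiemannianManifolds2018]
* B. O'Neill, *Semi-Riemannian Geometry*, Academic Press 1983, Ch. 2, Lemma 2.24. [ONeill1983]
-/

noncomputable section

open Bundle Set Filter Function MeasureTheory MeasureTheory.Measure Manifold
open scoped Manifold ContDiff Topology ENNReal NNReal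

/-! ## Part A. The area formula for injective `C¹` maps from Euclidean space into a Riemannian
manifold, and null images -/

namespace Literature.Geometry.Lorentzian

section AreaFormula

variable {H : Type*} [TopologicalSpace H] {n : ℕ∞ω} {m : ℕ}
  {I : ModelWithCorners ℝ (EuclideanSpace ℝ (Fin m)) H} [I.Boundaryless]
  {N : Type*} [TopologicalSpace N] [ChartedSpace H N] [IsManifold I 1 N]


/-- **Change of chart in the volume density** (Lee 2018, Prop. 2.41 ff.: independence of
`√(det g) dx` of the chart). Let `c = extChartAt p` be an atlas chart of `N`, `Φ : ℝᵐ → N`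
differentiable at `z` with `Φ z ∈ c.source`, and `ψ = c ∘ Φ`. Then
`|det Dψ(z)| √(det h^c_{ij}(ψ z)) = √(det h(dΦ_z eᵢ, dΦ_z eⱼ))`: by the chain rule
`dΦ_z = d(c⁻¹) ∘ Dψ(z)`, so `(h(dΦ eᵢ, dΦ eⱼ)) = [Dψ]ᵀ (h^c_{ij}) [Dψ]` (`sqrt_det_gram_comp`).
[folklore] -/
theorem abs_det_fderiv_comp_mul_sqrt_det_chartGramMatrix
    (h : ContMDiffRiemannianMetric I n (EuclideanSpace ℝ (Fin m)) (TangentSpace I : N → Type _)) (Φ : (EuclideanSpace ℝ (Fin m)) → N) (p : N)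
    {z : (EuclideanSpace ℝ (Fin m))} (hΦ : MDifferentiableAt 𝓘(ℝ, (EuclideanSpace ℝ (Fin m))) I Φ z) (hsrc : Φ z ∈ (extChartAt I p).source) :
    |(fderiv ℝ (fun z ↦ extChartAt I p (Φ z)) z).det| *
        Real.sqrt (chartGramMatrix h p (extChartAt I p (Φ z))).det =
      Real.sqrt (Matrix.of fun i j ↦ h.inner (Φ z)
        (mfderiv 𝓘(ℝ, (EuclideanSpace ℝ (Fin m))) I Φ z (EuclideanSpace.single i 1))
        (mfderiv 𝓘(ℝ, (EuclideanSpace ℝ (Fin m))) I Φ z (EuclideanSpace.single j 1))).det := by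
  set c := extChartAt I p with hc_def
  set ψ : (EuclideanSpace ℝ (Fin m)) → (EuclideanSpace ℝ (Fin m)) := fun z ↦ c (Φ z) with hψ_def
  have hsrc' : Φ z ∈ (chartAt H p).source := by rwa [← extChartAt_source I]
  have hcd : MDifferentiableAt I 𝓘(ℝ, (EuclideanSpace ℝ (Fin m))) c (Φ z) := mdifferentiableAt_extChartAt hsrc'
  have htgt : ψ z ∈ c.target := c.map_source hsrc
  have hcsd : MDifferentiableAt 𝓘(ℝ, (EuclideanSpace ℝ (Fin m))) I c.symm (ψ z) := by
    have := mdifferentiableWithinAt_extChartAt_symm htgt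
    rwa [ModelWithCorners.range_eq_univ, mdifferentiableWithinAt_univ] at this
  have hψd : MDifferentiableAt 𝓘(ℝ, (EuclideanSpace ℝ (Fin m))) 𝓘(ℝ, (EuclideanSpace ℝ (Fin m))) ψ z := hcd.comp z hΦ
  have hψfd : mfderiv 𝓘(ℝ, (EuclideanSpace ℝ (Fin m))) 𝓘(ℝ, (EuclideanSpace ℝ (Fin m))) ψ z = fderiv ℝ ψ z := mfderiv_eq_fderiv
  -- the chain rule `dΦ = d(c⁻¹) ∘ Dψ`
  have hev : Φ =ᶠ[𝓝 z] (c.symm ∘ ψ) := by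
    have h1 : ∀ᶠ z' in 𝓝 z, Φ z' ∈ c.source :=
      hΦ.continuousAt.preimage_mem_nhds ((isOpen_extChartAt_source (I := I) p).mem_nhds hsrc)
    filter_upwards [h1] with z' hz'
    exact (c.left_inv hz').symm
  set L₁ : (EuclideanSpace ℝ (Fin m)) →L[ℝ] (EuclideanSpace ℝ (Fin m)) := mfderiv 𝓘(ℝ, (EuclideanSpace ℝ (Fin m))) I c.symm (ψ z) with hL₁
  set L₂ : (EuclideanSpace ℝ (Fin m)) →L[ℝ] (EuclideanSpace ℝ (Fin m)) := fderiv ℝ ψ z with hL₂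
  have hchain : ∀ v : (EuclideanSpace ℝ (Fin m)), mfderiv 𝓘(ℝ, (EuclideanSpace ℝ (Fin m))) I Φ z v = L₁ (L₂ v) := by
    have h := ((hcsd.hasMFDerivAt.comp z hψd.hasMFDerivAt).congr_of_eventuallyEq hev).mfderiv
    intro v
    rw [h, hψfd]
    rfl
  -- the metric at `Φ z`, read as a bilinear form on `ℝᵐ`, composed with `L₁`
  obtain ⟨hin, hhin⟩ : ∃ hin : (EuclideanSpace ℝ (Fin m)) →L[ℝ] (EuclideanSpace ℝ (Fin m)) →L[ℝ] ℝ, hin = h.inner (Φ z) := ⟨_, rfl⟩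
  set B : LinearMap.BilinForm ℝ (EuclideanSpace ℝ (Fin m)) := LinearMap.mk₂ ℝ (fun v w ↦ hin (L₁ v) (L₁ w))
    (fun v₁ v₂ w ↦ by simp only [map_add, FunLike.coe_add, Pi.add_apply])
    (fun a v w ↦ by simp only [map_smul, FunLike.coe_smul, Pi.smul_apply, smul_eq_mul])
    (fun v w₁ w₂ ↦ by simp only [map_add])
    (fun a v w ↦ by simp only [map_smul, smul_eq_mul]) with hB
  have hB_apply : ∀ v w, B v w = hin (L₁ v) (L₁ w) := fun v w ↦ rfl
  set b := (EuclideanSpace.basisFun (Fin m) ℝ).toBasis with hb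
  have hb_apply : ∀ i, b i = EuclideanSpace.single i 1 := fun i ↦ by
    rw [hb, OrthonormalBasis.coe_toBasis, EuclideanSpace.basisFun_apply]
  have hgram : (Matrix.of fun i j ↦ h.inner (Φ z)
      (mfderiv 𝓘(ℝ, (EuclideanSpace ℝ (Fin m))) I Φ z (EuclideanSpace.single i 1))
      (mfderiv 𝓘(ℝ, (EuclideanSpace ℝ (Fin m))) I Φ z (EuclideanSpace.single j 1))) =
      Matrix.of fun i j ↦ B ((L₂ : (EuclideanSpace ℝ (Fin m)) →ₗ[ℝ] (EuclideanSpace ℝ (Fin m))) (b i)) ((L₂ : (EuclideanSpace ℝ (Fin m)) →ₗ[ℝ] (EuclideanSpace ℝ (Fin m))) (b j)) := by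
    ext i j
    rw [Matrix.of_apply, Matrix.of_apply, hB_apply, ContinuousLinearMap.coe_coe, hb_apply,
      hb_apply, hchain, hchain, hhin]
    rfl
  have heq : c.symm (ψ z) = Φ z := c.left_inv hsrc
  have hchart : chartGramMatrix h p (ψ z) = Matrix.of fun i j ↦ B (b i) (b j) := by
    ext i j
    rw [Matrix.of_apply, hB_apply, hb_apply, hb_apply, chartGramMatrix, Matrix.of_apply]
    simp only [ModelWithCorners.range_eq_univ, mfderivWithin_univ]
    rw [heq, hhin]
    rfl
  rw [hgram, hchart, sqrt_det_gram_comp b B (L₂ : (EuclideanSpace ℝ (Fin m)) →ₗ[ℝ] (EuclideanSpace ℝ (Fin m)))]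

omit [I.Boundaryless] in
/-- Images of measurable sets under a map which is differentiable and injective on them and maps
them into one chart domain are measurable: `Φ A = c.source ∩ c⁻¹(ψ A)` with `ψ = c ∘ Φ` an
injective differentiable map of `ℝᵐ` (Mathlib's `measurable_image_of_fderivWithin`). [folklore] -/
theorem measurableSet_image_of_mdifferentiableAt_of_injOn [MeasurableSpace N] [BorelSpace N]
    (Φ : (EuclideanSpace ℝ (Fin m)) → N) (p : N) {A : Set (EuclideanSpace ℝ (Fin m))} (hA : MeasurableSet A)
    (hd : ∀ z ∈ A, MDifferentiableAt 𝓘(ℝ, (EuclideanSpace ℝ (Fin m))) I Φ z) (hinj : InjOn Φ A)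
    (hsrc : ∀ z ∈ A, Φ z ∈ (extChartAt I p).source) : MeasurableSet (Φ '' A) := by
  set c := extChartAt I p with hc_def
  set ψ : (EuclideanSpace ℝ (Fin m)) → (EuclideanSpace ℝ (Fin m)) := fun z ↦ c (Φ z) with hψ_def
  have hψm : MeasurableSet (ψ '' A) := by
    refine measurable_image_of_fderivWithin hA (f' := fun z ↦ fderiv ℝ ψ z) (fun z hz ↦ ?_) ?_
    · have hsrc' : Φ z ∈ (chartAt H p).source := by rw [← extChartAt_source I]; exact hsrc z hz
      have hψd : MDifferentiableAt 𝓘(ℝ, (EuclideanSpace ℝ (Fin m))) 𝓘(ℝ, (EuclideanSpace ℝ (Fin m))) ψ z :=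
        (mdifferentiableAt_extChartAt hsrc').comp z (hd z hz)
      exact (mdifferentiableAt_iff_differentiableAt.1 hψd).hasFDerivAt.hasFDerivWithinAt
    · intro z₁ h₁ z₂ h₂ h12
      exact hinj h₁ h₂ (c.injOn (hsrc z₁ h₁) (hsrc z₂ h₂) h12)
  have hset : Φ '' A = c.source ∩ c ⁻¹' (ψ '' A) := by
    ext x
    constructor
    · rintro ⟨z, hz, rfl⟩
      exact ⟨hsrc z hz, z, hz, rfl⟩
    · rintro ⟨hx, z, hz, hzx⟩
      exact ⟨z, hz, c.injOn (hsrc z hz) hx hzx⟩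
  rw [hset]
  exact measurableSet_source_inter_preimage_extChartAt p hψm

/-- **The Jacobian density of a `C¹` map into a Riemannian manifold is continuous**: for
`Φ : ℝᵐ → N` of class `C¹`, `z ↦ √(det h(dΦ_z eᵢ, dΦ_z eⱼ))` is continuous — near each point it
is `|det D(c ∘ Φ)(z)| √(det h^c_{ij}(c(Φ z)))` in an atlas chart `c`
(`abs_det_fderiv_comp_mul_sqrt_det_chartGramMatrix`, `continuousOn_sqrt_det_chartGramMatrix`).
[folklore] -/
theorem continuous_sqrt_det_inner_mfderiv
    (h : ContMDiffRiemannianMetric I n (EuclideanSpace ℝ (Fin m)) (TangentSpace I : N → Type _)) {Φ : (EuclideanSpace ℝ (Fin m)) → N}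
    (hΦ : ContMDiff 𝓘(ℝ, (EuclideanSpace ℝ (Fin m))) I 1 Φ) :
    Continuous fun z ↦ Real.sqrt (Matrix.of fun i j : Fin m ↦ h.inner (Φ z)
        (mfderiv 𝓘(ℝ, (EuclideanSpace ℝ (Fin m))) I Φ z (EuclideanSpace.single i 1))
        (mfderiv 𝓘(ℝ, (EuclideanSpace ℝ (Fin m))) I Φ z (EuclideanSpace.single j 1))).det := by
  refine continuous_iff_continuousAt.2 fun z₀ ↦ ?_
  set p := Φ z₀ with hp
  set O : Set (EuclideanSpace ℝ (Fin m)) := Φ ⁻¹' (extChartAt I p).source with hO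
  have hOo : IsOpen O := (isOpen_extChartAt_source (I := I) p).preimage hΦ.continuous
  have hz₀ : z₀ ∈ O := mem_extChartAt_source (I := I) p
  -- `ψ = c ∘ Φ` is `C¹` on `O`
  have hψ : ContDiffOn ℝ 1 (fun z ↦ extChartAt I p (Φ z)) O := by
    rw [← contMDiffOn_iff_contDiffOn]
    refine (contMDiffOn_extChartAt (n := 1) (I := I) (x := p)).comp hΦ.contMDiffOn fun z hz ↦ ?_
    show Φ z ∈ (chartAt H p).source
    rw [← extChartAt_source I]
    exact hz
  have hDψ : ContinuousOn (fderiv ℝ fun z ↦ extChartAt I p (Φ z)) O :=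
    hψ.continuousOn_fderiv_of_isOpen hOo le_rfl
  have hF : ContinuousOn (fun z ↦ |(fderiv ℝ (fun z ↦ extChartAt I p (Φ z)) z).det| *
      Real.sqrt (chartGramMatrix h p (extChartAt I p (Φ z))).det) O := by
    refine (continuous_abs.comp_continuousOn
      (ContinuousLinearMap.continuous_det.comp_continuousOn hDψ)).mul ?_
    refine (continuousOn_sqrt_det_chartGramMatrix h p).comp
      ((continuousOn_extChartAt p).comp hΦ.continuous.continuousOn fun z hz ↦ hz)
      fun z hz ↦ ?_
    exact (extChartAt I p).map_source hz
  have hEq : EqOn (fun z ↦ Real.sqrt (Matrix.of fun i j : Fin m ↦ h.inner (Φ z)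
        (mfderiv 𝓘(ℝ, (EuclideanSpace ℝ (Fin m))) I Φ z (EuclideanSpace.single i 1))
        (mfderiv 𝓘(ℝ, (EuclideanSpace ℝ (Fin m))) I Φ z (EuclideanSpace.single j 1))).det)
      (fun z ↦ |(fderiv ℝ (fun z ↦ extChartAt I p (Φ z)) z).det| *
        Real.sqrt (chartGramMatrix h p (extChartAt I p (Φ z))).det) O := fun z hz ↦
    (abs_det_fderiv_comp_mul_sqrt_det_chartGramMatrix h Φ p
      ((hΦ z).mdifferentiableAt one_ne_zero) hz).symm
  exact (hF.congr hEq).continuousAt (hOo.mem_nhds hz₀)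

variable [T3Space N] [MeasurableSpace N] [BorelSpace N]

/-- **The area formula near each point** (Federer 1969, §3.2.3, §3.2.46; Lee 2018, Prop. 2.41):
for a map `Φ : ℝᵐ → N` differentiable at the points of an open set `W` and injective on `W`,
every `z₀ ∈ W` has an open neighbourhood `V ⊆ W` such that for every measurable `A ⊆ V`,
`vol_h(Φ A) = ∫_A √(det h(dΦ eᵢ, dΦ eⱼ)) dz` — the chart formula
(`riemannianMeasure_eq_integral_sqrt_det_holds`) in an atlas chart at `Φ z₀`, transported along
`c ∘ Φ` by the Euclidean change of variables (`lintegral_image_eq_lintegral_abs_det_fderiv_mul`)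
and `abs_det_fderiv_comp_mul_sqrt_det_chartGramMatrix`.
[cite: Federer1969, §3.2.3 and §3.2.46] -/
theorem exists_nhds_riemannianMeasure_image_eq
    (h : ContMDiffRiemannianMetric I n (EuclideanSpace ℝ (Fin m)) (TangentSpace I : N → Type _)) {W : Set (EuclideanSpace ℝ (Fin m))}
    (hW : IsOpen W) {Φ : (EuclideanSpace ℝ (Fin m)) → N}
    (hd : ∀ z ∈ W, MDifferentiableAt 𝓘(ℝ, (EuclideanSpace ℝ (Fin m))) I Φ z) (hinj : InjOn Φ W) {z₀ : (EuclideanSpace ℝ (Fin m))} (hz₀ : z₀ ∈ W) :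
    ∃ V : Set (EuclideanSpace ℝ (Fin m)), IsOpen V ∧ z₀ ∈ V ∧ V ⊆ W ∧
      ∀ A ⊆ V, MeasurableSet A →
        riemannianMeasure (I := I) h (Φ '' A) =
          ∫⁻ z in A, ENNReal.ofReal (Real.sqrt (Matrix.of fun i j : Fin m ↦ h.inner (Φ z)
            (mfderiv 𝓘(ℝ, (EuclideanSpace ℝ (Fin m))) I Φ z (EuclideanSpace.single i 1))
            (mfderiv 𝓘(ℝ, (EuclideanSpace ℝ (Fin m))) I Φ z (EuclideanSpace.single j 1))).det) := by
  set p₀ := Φ z₀ with hp₀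
  set c := extChartAt I p₀ with hc
  have hcont : ContinuousOn Φ W := fun z hz ↦ (hd z hz).continuousAt.continuousWithinAt
  have hz₀V : z₀ ∈ W ∩ Φ ⁻¹' c.source := ⟨hz₀, mem_extChartAt_source (I := I) p₀⟩
  have hVo : IsOpen (W ∩ Φ ⁻¹' c.source) :=
    hcont.isOpen_inter_preimage hW (isOpen_extChartAt_source (I := I) p₀)
  refine ⟨W ∩ Φ ⁻¹' c.source, hVo, hz₀V, inter_subset_left, fun A hAV hA ↦ ?_⟩
  have hAW : A ⊆ W := fun z hz ↦ (hAV hz).1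
  have hAsrc : ∀ z ∈ A, Φ z ∈ c.source := fun z hz ↦ (hAV hz).2
  have hAsrc' : Φ '' A ⊆ c.source := by
    rintro _ ⟨z, hz, rfl⟩
    exact hAsrc z hz
  have hS : MeasurableSet (Φ '' A) :=
    measurableSet_image_of_mdifferentiableAt_of_injOn Φ p₀ hA (fun z hz ↦ hd z (hAW hz))
      (hinj.mono hAW) hAsrc
  rw [riemannianMeasure_eq_integral_sqrt_det_holds h p₀ hS hAsrc']
  set ψ : (EuclideanSpace ℝ (Fin m)) → (EuclideanSpace ℝ (Fin m)) := fun z ↦ c (Φ z) with hψ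
  have himage : c '' (Φ '' A) = ψ '' A := image_image _ _ _
  have hdiff : ∀ z ∈ A, HasFDerivWithinAt ψ (fderiv ℝ ψ z) A z := by
    intro z hz
    have hsrc' : Φ z ∈ (chartAt H p₀).source := by
      rw [← extChartAt_source I]
      exact hAsrc z hz
    have hψd : MDifferentiableAt 𝓘(ℝ, (EuclideanSpace ℝ (Fin m))) 𝓘(ℝ, (EuclideanSpace ℝ (Fin m))) ψ z :=
      (mdifferentiableAt_extChartAt hsrc').comp z (hd z (hAW hz))
    exact (mdifferentiableAt_iff_differentiableAt.1 hψd).hasFDerivAt.hasFDerivWithinAt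
  have hinjψ : InjOn ψ A := by
    intro z₁ h₁ z₂ h₂ h12
    exact hinj (hAW h₁) (hAW h₂) (c.injOn (hAsrc z₁ h₁) (hAsrc z₂ h₂) h12)
  rw [himage, lintegral_image_eq_lintegral_abs_det_fderiv_mul volume hA hdiff hinjψ]
  refine setLIntegral_congr_fun hA fun z hz ↦ ?_
  rw [← ENNReal.ofReal_mul (abs_nonneg _),
    abs_det_fderiv_comp_mul_sqrt_det_chartGramMatrix h Φ p₀ (hd z (hAW hz)) (hAsrc z hz)]

/-- **The area formula for an injective `C¹` map from Euclidean space into a Riemannian manifold**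
(Federer 1969, Thm. 3.2.3 with §3.2.46; Lee 2018, Prop. 2.41 ff.; Chavel 2006, §III.3,
(III.3.5)): if `Φ : ℝᵐ → N` is differentiable at the points of an open set `W ⊆ ℝᵐ` and injective
on `W`, then for every measurable `A ⊆ W` the Riemannian measure of `Φ(A)` is
`∫_A √(det h(dΦ_z eᵢ, dΦ_z eⱼ)) dz`. Proof: the local statement
`exists_nhds_riemannianMeasure_image_eq` on a countable cover of `W`, disjointified.
[cite: Federer1969, §3.2.3 and §3.2.46] -/
theorem riemannianMeasure_image_eq_lintegral_of_injOn
    (h : ContMDiffRiemannianMetric I n (EuclideanSpace ℝ (Fin m)) (TangentSpace I : N → Type _)) {W : Set (EuclideanSpace ℝ (Fin m))}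
    (hW : IsOpen W) {Φ : (EuclideanSpace ℝ (Fin m)) → N} (hd : ∀ z ∈ W, MDifferentiableAt 𝓘(ℝ, (EuclideanSpace ℝ (Fin m))) I Φ z)
    (hinj : InjOn Φ W) {A : Set (EuclideanSpace ℝ (Fin m))} (hA : MeasurableSet A) (hAW : A ⊆ W) :
    riemannianMeasure (I := I) h (Φ '' A) =
      ∫⁻ z in A, ENNReal.ofReal (Real.sqrt (Matrix.of fun i j : Fin m ↦ h.inner (Φ z)
        (mfderiv 𝓘(ℝ, (EuclideanSpace ℝ (Fin m))) I Φ z (EuclideanSpace.single i 1))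
        (mfderiv 𝓘(ℝ, (EuclideanSpace ℝ (Fin m))) I Φ z (EuclideanSpace.single j 1))).det) := by
  classical
  set dens : (EuclideanSpace ℝ (Fin m)) → ℝ≥0∞ := fun z ↦ ENNReal.ofReal (Real.sqrt (Matrix.of fun i j : Fin m ↦
    h.inner (Φ z) (mfderiv 𝓘(ℝ, (EuclideanSpace ℝ (Fin m))) I Φ z (EuclideanSpace.single i 1))
      (mfderiv 𝓘(ℝ, (EuclideanSpace ℝ (Fin m))) I Φ z (EuclideanSpace.single j 1))).det) with hdens
  -- the empty case
  rcases W.eq_empty_or_nonempty with hWe | hWne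
  · have hAe : A = ∅ := subset_eq_empty hAW hWe
    subst hAe
    simp
  -- a countable cover of `W` by neighbourhoods on which the formula holds
  choose V hVo hVz hVW hV using fun (z : (EuclideanSpace ℝ (Fin m))) (hz : z ∈ W) ↦
    exists_nhds_riemannianMeasure_image_eq h hW hd hinj hz
  set f : (EuclideanSpace ℝ (Fin m)) → Set (EuclideanSpace ℝ (Fin m)) := fun z ↦ if hz : z ∈ W then V z hz else ∅ with hf
  have hfV : ∀ {z : (EuclideanSpace ℝ (Fin m))} (hz : z ∈ W), f z = V z hz := fun hz ↦ dif_pos hz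
  have hfn : ∀ z ∈ W, f z ∈ 𝓝[W] z := fun z hz ↦ by
    rw [hfV hz]
    exact mem_nhdsWithin_of_mem_nhds ((hVo z hz).mem_nhds (hVz z hz))
  obtain ⟨t, htW, htc, hcover⟩ := TopologicalSpace.countable_cover_nhdsWithin hfn
  have htne : t.Nonempty := by
    obtain ⟨z, hz⟩ := hWne
    obtain ⟨x, hx, -⟩ := mem_iUnion₂.1 (hcover hz)
    exact ⟨x, hx⟩
  obtain ⟨u, hu⟩ := htc.exists_eq_range htne
  have huW : ∀ k, u k ∈ W := fun k ↦ htW (by rw [hu]; exact mem_range_self k)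
  -- the disjointified cover and the pieces of `A`
  set U : ℕ → Set (EuclideanSpace ℝ (Fin m)) := fun k ↦ f (u k) with hU
  have hUV : ∀ k, U k = V (u k) (huW k) := fun k ↦ hfV (huW k)
  have hUm : ∀ k, MeasurableSet (U k) := fun k ↦ by
    rw [hUV k]; exact (hVo _ _).measurableSet
  set D : ℕ → Set (EuclideanSpace ℝ (Fin m)) := disjointed U with hD
  have hDm : ∀ k, MeasurableSet (D k) := MeasurableSet.disjointed hUm
  have hDU : ∀ k, D k ⊆ U k := fun k ↦ disjointed_subset U k
  have hAcov : A ⊆ ⋃ k, D k := by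
    intro z hz
    have h1 := hcover (hAW hz)
    rw [hu] at h1
    obtain ⟨x, ⟨k, rfl⟩, hzk⟩ := mem_iUnion₂.1 h1
    have h2 : z ∈ ⋃ k, U k := mem_iUnion.2 ⟨k, hzk⟩
    rwa [← iUnion_disjointed] at h2
  have hAeq : A = ⋃ k, A ∩ D k := by
    rw [← inter_iUnion]
    exact (inter_eq_left.2 hAcov).symm
  have hpieces_m : ∀ k, MeasurableSet (A ∩ D k) := fun k ↦ hA.inter (hDm k)
  have hpieces_d : Pairwise (Disjoint on fun k ↦ A ∩ D k) := fun i j hij ↦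
    (disjoint_disjointed U hij).mono inter_subset_right inter_subset_right
  have hpieces_W : ∀ k, A ∩ D k ⊆ W := fun k z hz ↦ hAW hz.1
  -- the images of the pieces are disjoint and measurable
  have himg_d : Pairwise (Disjoint on fun k ↦ Φ '' (A ∩ D k)) := by
    intro i j hij
    rw [Function.onFun, Set.disjoint_iff_inter_eq_empty,
      ← hinj.image_inter (hpieces_W i) (hpieces_W j),
      Set.disjoint_iff_inter_eq_empty.1 (hpieces_d hij), image_empty]
  have himg_m : ∀ k, MeasurableSet (Φ '' (A ∩ D k)) := by
    intro k
    have hsub : A ∩ D k ⊆ V (u k) (huW k) := fun z hz ↦ by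
      rw [← hUV k]; exact hDU k hz.2
    -- measurability from the local formula's chart: re-derive via the general lemma at a chart
    -- containing the image is not available; instead use that `Φ` restricted to `W` is an
    -- injective continuous map on a measurable set of a Polish space
    exact hA.inter (hDm k) |>.image_of_continuousOn_injOn
      (fun z hz ↦ (hd z (hpieces_W k hz)).continuousAt.continuousWithinAt)
      (hinj.mono (hpieces_W k))
  -- summing the local formula over the pieces
  calc riemannianMeasure (I := I) h (Φ '' A)
      = riemannianMeasure (I := I) h (⋃ k, Φ '' (A ∩ D k)) := by
        rw [← image_iUnion, ← hAeq]
    _ = ∑' k, riemannianMeasure (I := I) h (Φ '' (A ∩ D k)) := measure_iUnion himg_d himg_m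
    _ = ∑' k, ∫⁻ z in A ∩ D k, dens z := by
        refine tsum_congr fun k ↦ ?_
        have hsub : A ∩ D k ⊆ V (u k) (huW k) := fun z hz ↦ by
          rw [← hUV k]; exact hDU k hz.2
        exact hV (u k) (huW k) _ hsub (hpieces_m k)
    _ = ∫⁻ z in ⋃ k, A ∩ D k, dens z := (lintegral_iUnion hpieces_m hpieces_d dens).symm
    _ = ∫⁻ z in A, dens z := by rw [← hAeq]

omit [I.Boundaryless] in
/-- **Differentiable maps send Lebesgue-null sets to sets of Riemannian measure zero** (Federer
1969, §3.2.3 / Sard-type null-set lemma; Lee 2018, Prop. 6.5 for the Euclidean statement): if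
`Φ : ℝᵐ → N` is differentiable at the points of an open `W` and `A ⊆ W` has Lebesgue measure
zero, then `vol_h(Φ A) = 0` — in each chart `c`, `c(Φ A)` is the image of a null set under the
differentiable map `c ∘ Φ` (Mathlib's `addHaar_image_eq_zero_of_differentiableOn_of_addHaar_eq_zero`)
and the Riemannian measure has a density against Lebesgue measure in charts
(`map_extChartAt_restrict_riemannianMeasure`). No injectivity is needed. [folklore] -/
theorem riemannianMeasure_image_eq_zero_of_volume_eq_zero
    (h : ContMDiffRiemannianMetric I n (EuclideanSpace ℝ (Fin m)) (TangentSpace I : N → Type _)) {W : Set (EuclideanSpace ℝ (Fin m))}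
    (hW : IsOpen W) {Φ : (EuclideanSpace ℝ (Fin m)) → N} (hd : ∀ z ∈ W, MDifferentiableAt 𝓘(ℝ, (EuclideanSpace ℝ (Fin m))) I Φ z)
    {A : Set (EuclideanSpace ℝ (Fin m))} (hAW : A ⊆ W) (hA0 : volume A = 0) :
    riemannianMeasure (I := I) h (Φ '' A) = 0 := by
  have hcont : ContinuousOn Φ W := fun z hz ↦ (hd z hz).continuousAt.continuousWithinAt
  -- cover `A` by the preimages of chart domains
  set O : (EuclideanSpace ℝ (Fin m)) → Set (EuclideanSpace ℝ (Fin m)) := fun z ↦ W ∩ Φ ⁻¹' (extChartAt I (Φ z)).source with hO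
  have hOo : ∀ z, IsOpen (O z) := fun z ↦
    hcont.isOpen_inter_preimage hW (isOpen_extChartAt_source (I := I) (Φ z))
  have hOz : ∀ z ∈ A, z ∈ O z := fun z hz ↦ ⟨hAW hz, mem_extChartAt_source (I := I) (Φ z)⟩
  have hOn : ∀ z ∈ A, O z ∈ 𝓝[A] z := fun z hz ↦
    mem_nhdsWithin_of_mem_nhds ((hOo z).mem_nhds (hOz z hz))
  obtain ⟨t, -, htc, hcover⟩ := TopologicalSpace.countable_cover_nhdsWithin hOn
  have hsub : Φ '' A ⊆ ⋃ z ∈ t, Φ '' (A ∩ O z) := by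
    rintro _ ⟨a, ha, rfl⟩
    obtain ⟨z, hz, haz⟩ := mem_iUnion₂.1 (hcover ha)
    exact mem_iUnion₂.2 ⟨z, hz, a, ⟨ha, haz⟩, rfl⟩
  refine measure_mono_null hsub ((measure_biUnion_null_iff htc).2 fun z _ ↦ ?_)
  -- one chart piece
  set c := extChartAt I (Φ z) with hc
  set ψ : (EuclideanSpace ℝ (Fin m)) → (EuclideanSpace ℝ (Fin m)) := fun a ↦ c (Φ a) with hψ
  have hψd : DifferentiableOn ℝ ψ (A ∩ O z) := by
    intro a ha
    have hsrc' : Φ a ∈ (chartAt H (Φ z)).source := by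
      rw [← extChartAt_source I]; exact ha.2.2
    have h1 : MDifferentiableAt 𝓘(ℝ, (EuclideanSpace ℝ (Fin m))) 𝓘(ℝ, (EuclideanSpace ℝ (Fin m))) ψ a :=
      (mdifferentiableAt_extChartAt hsrc').comp a (hd a ha.2.1)
    exact (mdifferentiableAt_iff_differentiableAt.1 h1).differentiableWithinAt
  have hψ0 : volume (ψ '' (A ∩ O z)) = 0 :=
    addHaar_image_eq_zero_of_differentiableOn_of_addHaar_eq_zero volume hψd
      (measure_mono_null inter_subset_left hA0)
  obtain ⟨B, hBsub, hBm, hB0⟩ := exists_measurable_superset_of_null hψ0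
  -- `Φ (A ∩ O z) ⊆ c.source ∩ c⁻¹ B`, a set of Riemannian measure zero
  have hsub2 : Φ '' (A ∩ O z) ⊆ c ⁻¹' B ∩ c.source := by
    rintro _ ⟨a, ha, rfl⟩
    exact ⟨hBsub ⟨a, ha, rfl⟩, ha.2.2⟩
  refine measure_mono_null hsub2 ?_
  have hs : MeasurableSet c.source := (isOpen_extChartAt_source (I := I) (Φ z)).measurableSet
  have hmap := congrArg (fun μ : Measure (EuclideanSpace ℝ (Fin m)) ↦ μ B) (map_extChartAt_restrict_riemannianMeasure h (Φ z))
  rw [Measure.map_apply_of_aemeasurable (aemeasurable_extChartAt_restrict (Φ z) _) hBm,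
    Measure.restrict_apply' hs] at hmap
  rw [hmap]
  have hac : ((volume : Measure (EuclideanSpace ℝ (Fin m))).restrict c.target).withDensity
      (fun y ↦ ENNReal.ofReal (Real.sqrt (chartGramMatrix h (Φ z) y).det)) ≪ volume :=
    (withDensity_absolutelyContinuous _ _).trans Measure.restrict_le_self.absolutelyContinuous
  exact hac hB0

end AreaFormula

end Literature.Geometry.Lorentzian

/-! ## Part B. The normal Jacobi tensor of `exp_p` in a parallel frame, with the Jacobi fields
identified with the differential of `exp_p` -/

namespace Literature.Geometry.Riemannian

open Lorentzian Lorentzian.PseudoRiemannianMetric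

section JacobiFrame

variable {E : Type*} [NormedAddCommGroup E] [NormedSpace ℝ E] {H : Type*} [TopologicalSpace H]
  {I : ModelWithCorners ℝ E H} {M : Type*} [TopologicalSpace M] [ChartedSpace H M]
  [IsManifold I ∞ M] [FiniteDimensional ℝ E] {n : ℕ∞ω}
  [CompleteSpace E] [T2Space M] [I.Boundaryless] [Fact (1 ≤ n)]
  (g : PseudoRiemannianMetric I n E (TangentSpace I : M → Type _)) [g.HasLeviCivita]
  [CovariantDerivative.ContMDiffCovariantDerivative g.leviCivita 1]
  [CovariantDerivative.ContMDiffCovariantDerivative g.leviCivita ∞]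

/-- **The normal Jacobi tensor in a parallel orthonormal frame, with the Jacobi fields written as
`J_k(t) = d(exp_p)_{tv}(t e_k(0))`** (Chavel 2006, §III.1–III.4: the matrix `𝒜(t;ξ)` of
Thm. III.4.3 and the identification (III.2) of Jacobi fields vanishing at `p` with the differential
of `exp_p`; PSU 2023, Prop. 3.7.10). This is `normalJacobiTensor_frame` of
`VolumeSphereTheoremJacobiFrameProofs.lean` (same hypotheses and conclusions `A' = A₁`,
`A₁' = -RA`, `Rᵀ = R`, `tr R = Ric(γ̇, γ̇)`, `A(0) = 0`, `A₁(0) = 1`, `det A(t) ≠ 0` where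
`d(exp_p)_{tv}` is injective), with three more recorded properties of the Jacobi fields `J_k`
built in its proof: `J_k(t) = d(exp_p)_{tv}(t e_k(0))` (`velocity_geodesicVariation_eq_mfderiv_expMap`),
`g(J_k, γ̇) = 0`, and the frame expansion `J_k(t) = ∑ᵢ A_{ik}(t) eᵢ(t)` on `(a, b)`.
[cite: Chavel2006, §III.4, Thm. III.4.3 (set-up) and §III.2] -/
theorem normalJacobiTensor_frame_expMap (hreg : g.leviCivita.IsLocallyContMDiff 1) (hn : 2 ≤ n)
    (hc : IsGeodesicallyComplete g.leviCivita) (p : M) (v : TangentSpace I p)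
    {ι : Type*} [Fintype ι] [DecidableEq ι] {a b : ℝ} (h0 : (0 : ℝ) ∈ Ioo a b)
    (f : Π t : ℝ, Option ι → TangentSpace I (maximalGeodesic g.leviCivita p v t))
    (hfnone : ∀ t, f t none = velocity I (maximalGeodesic g.leviCivita p v) t)
    (hfpar : ∀ i, IsParallelAlongOn g.leviCivita (maximalGeodesic g.leviCivita p v)
      (fun t ↦ f t (some i)) (Ioo a b))
    (hon : ∀ t ∈ Ioo a b, ∀ o o', g.val (maximalGeodesic g.leviCivita p v t) (f t o) (f t o') =
      if o = o' then 1 else 0)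
    (hcard : Fintype.card (Option ι) = Module.finrank ℝ E) :
    ∃ J : ι → Π t : ℝ, TangentSpace I (maximalGeodesic g.leviCivita p v t),
      let A : ℝ → Matrix ι ι ℝ := fun t ↦ Matrix.of fun i k ↦
        g.val (maximalGeodesic g.leviCivita p v t) (J k t) (f t (some i))
      let A₁ : ℝ → Matrix ι ι ℝ := fun t ↦ Matrix.of fun i k ↦
        g.val (maximalGeodesic g.leviCivita p v t)
          (covariantDerivAlong g.leviCivita (maximalGeodesic g.leviCivita p v) (J k) t) (f t (some i))
      let R : ℝ → Matrix ι ι ℝ := fun t ↦ Matrix.of fun i j ↦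
        g.val (maximalGeodesic g.leviCivita p v t) (g.leviCivita.curvature
          (maximalGeodesic g.leviCivita p v t) (f t (some j))
          (velocity I (maximalGeodesic g.leviCivita p v) t)
          (velocity I (maximalGeodesic g.leviCivita p v) t)) (f t (some i))
      (∀ t ∈ Ioo a b, HasDerivAt A (A₁ t) t) ∧
      (∀ t ∈ Ioo a b, HasDerivAt A₁ (-(R t * A t)) t) ∧
      (∀ t ∈ Ioo a b, (R t).IsSymm) ∧
      (∀ t ∈ Ioo a b, (R t).trace = g.leviCivita.ricci (maximalGeodesic g.leviCivita p v t)
        (velocity I (maximalGeodesic g.leviCivita p v) t)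
        (velocity I (maximalGeodesic g.leviCivita p v) t)) ∧
      A 0 = 0 ∧ A₁ 0 = 1 ∧
      (∀ t ∈ Ioo a b, t ≠ 0 → Injective (mfderiv 𝓘(ℝ, E) I
        (fun u : E ↦ expMap g.leviCivita p (show TangentSpace I p from u)) (t • (show E from v))) →
        (A t).det ≠ 0) ∧
      (∀ k t, (J k t : E) = mfderiv 𝓘(ℝ, E) I
        (fun u : E ↦ expMap g.leviCivita p (show TangentSpace I p from u)) (t • (v : E))
        (t • (f 0 (some k) : E))) ∧
      (∀ k t, g.val (maximalGeodesic g.leviCivita p v t) (J k t)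
        (velocity I (maximalGeodesic g.leviCivita p v) t) = 0) ∧
      (∀ t ∈ Ioo a b, ∀ k, J k t = ∑ i, A t i k • f t (some i)) := by
  have hLC := PseudoRiemannianMetric.isLeviCivita_leviCivita_holds (g := g)
  obtain ⟨-, hgeo, hγ0, hγv⟩ := maximalGeodesic_of_isGeodesicallyComplete hc p v
  -- the initial derivatives `w_k = e_k(0)` read in `T_pM`, and the variation fields
  set w : ι → TangentSpace I p := fun k ↦ (show E from f 0 (some k)) with hw
  have hvw : ∀ k, v + (0 : ℝ) • w k = v := fun k ↦ by rw [zero_smul, add_zero]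
  set J : ι → Π t : ℝ, TangentSpace I (maximalGeodesic g.leviCivita p v t) := fun k t ↦
    velocity I (fun s' : ℝ ↦ maximalGeodesic g.leviCivita p (v + s' • w k) t) 0 with hJdef
  have hJprop : ∀ k, IsJacobiFieldAlongOn g (maximalGeodesic g.leviCivita p v) (J k) univ ∧
      J k 0 = 0 ∧
      covariantDerivAlong g.leviCivita (maximalGeodesic g.leviCivita p v) (J k) 0 = w k ∧
      (∀ t, MDifferentiableAt 𝓘(ℝ, ℝ) I.tangent (fun t ↦ (TotalSpace.mk' E
        (maximalGeodesic g.leviCivita p v t) (J k t) : TangentBundle I M)) t) ∧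
      ∀ t, MDifferentiableAt 𝓘(ℝ, ℝ) I.tangent (fun t ↦ (TotalSpace.mk' E
        (maximalGeodesic g.leviCivita p v t)
        (covariantDerivAlong g.leviCivita (maximalGeodesic g.leviCivita p v) (J k) t) :
          TangentBundle I M)) t := by
    intro k
    have h := jacobiField_geodesicVariation g hreg hc p v (w k)
    rw [hvw k] at h
    exact h
  refine ⟨J, ?_⟩
  intro A A₁ R
  -- normality of the `J_k` and their expansion in the normal frame
  have hnormal : ∀ k t, g.val _ (J k t) (velocity I (maximalGeodesic g.leviCivita p v) t) = 0 ∧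
      g.val _ (covariantDerivAlong g.leviCivita (maximalGeodesic g.leviCivita p v) (J k) t)
        (velocity I (maximalGeodesic g.leviCivita p v) t) = 0 := by
    intro k t
    refine val_velocity_eq_zero_of_isJacobiFieldAlongOn g hreg hn hgeo (hJprop k).1
      (hJprop k).2.2.2.1 (hJprop k).2.2.2.2 ?_ ?_ t
    · rw [(hJprop k).2.1, map_zero, zero_apply]
    · rw [(hJprop k).2.2.1, ← hfnone 0]
      have h := hon 0 h0 (some k) none
      simpa using h
  have hexpand : ∀ t ∈ Ioo a b, ∀ u : TangentSpace I (maximalGeodesic g.leviCivita p v t),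
      g.val _ u (velocity I (maximalGeodesic g.leviCivita p v) t) = 0 →
        u = ∑ i, g.val _ u (f t (some i)) • f t (some i) := by
    intro t ht u hu
    refine eq_sum_normal_of_val_eq_zero g (maximalGeodesic g.leviCivita p v t) (hon t ht) hcard ?_
    rw [hfnone t]; exact hu
  refine ⟨?_, ?_, ?_, ?_, ?_, ?_, ?_, ?_, fun k t ↦ (hnormal k t).1, ?_⟩
  · -- `A' = A₁`
    intro t ht
    refine hasDerivAt_pi.2 fun i ↦ hasDerivAt_pi.2 fun k ↦ ?_
    simp only [A, A₁, Matrix.of_apply]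
    exact hasDerivAt_val_apply_of_isParallelAlongOn g hLC.2 ((hJprop k).2.2.2.1 t) (hfpar i) ht
  · -- `A₁' = -R A`
    intro t ht
    refine hasDerivAt_pi.2 fun i ↦ hasDerivAt_pi.2 fun k ↦ ?_
    simp only [A, A₁, R, Matrix.of_apply, Matrix.neg_apply, Matrix.mul_apply]
    exact hasDerivAt_val_covariantDerivAlong_frame_of_expansion g
      (fun s hs ↦ (hJprop k).1 s (mem_univ s)) ((hJprop k).2.2.2.2 t) hfpar ht
      (hexpand t ht (J k t) (hnormal k t).1) i
  · -- `Rᵀ = R`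
    intro t ht
    exact isSymm_frameMatrix_curvature g hLC.2 hreg hLC.1 hn (fun i t ↦ f t (some i)) t
  · -- `tr R = Ric(γ̇, γ̇)`
    intro t ht
    simp only [R, Matrix.trace, Matrix.diag_apply, Matrix.of_apply]
    have h := sum_val_curvature_normal_eq_ricci g g.leviCivita (maximalGeodesic g.leviCivita p v t)
      (hon t ht) hcard
    rw [hfnone t] at h
    exact h
  · -- `A(0) = 0`
    ext i k
    simp only [A, Matrix.of_apply, Matrix.zero_apply, (hJprop k).2.1, map_zero, zero_apply]
  · -- `A₁(0) = 1`
    ext i k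
    simp only [A₁, Matrix.of_apply, Matrix.one_apply, (hJprop k).2.2.1]
    have h := hon 0 h0 (some k) (some i)
    simp only [Option.some.injEq] at h
    rw [show g.val (maximalGeodesic g.leviCivita p v 0) (w k) (f 0 (some i)) =
      g.val (maximalGeodesic g.leviCivita p v 0) (f 0 (some k)) (f 0 (some i)) from rfl, h]
    by_cases hik : i = k
    · subst hik; simp
    · simp [hik, Ne.symm hik]
  · -- `det A(t) ≠ 0` where `d(exp_p)_{tv}` is injective
    intro t ht ht0 hinj
    have hw0 : LinearIndependent ℝ fun k ↦ (show E from w k) := by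
      have hon0 : ∀ i j, g.val (maximalGeodesic g.leviCivita p v 0) (f 0 (some i)) (f 0 (some j)) =
          if i = j then 1 else 0 := fun i j ↦ by
        have h := hon 0 h0 (some i) (some j)
        simp only [Option.some.injEq] at h
        exact h
      exact linearIndependent_of_bilin_orthonormal (V := E)
        (g.val (maximalGeodesic g.leviCivita p v 0)) hon0
    exact det_frameMatrix_ne_zero_of_mfderiv_expMap_injective_normal g hc p v w hw0
      (fun i t ↦ f t (some i)) ht0 (fun k ↦ (hnormal k t).1) (hexpand t ht) hinj
  · -- `J_k(t) = d(exp_p)_{tv}(t w_k)`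
    intro k t
    exact velocity_geodesicVariation_eq_mfderiv_expMap hc p v (w k) t
  · -- the frame expansion
    intro t ht k
    exact hexpand t ht (J k t) (hnormal k t).1

end JacobiFrame

end Literature.Geometry.Riemannian

/-! ## Part C. Two Gram-determinant lemmas -/

namespace Literature.Geometry.Riemannian

open Lorentzian Lorentzian.PseudoRiemannianMetric

section GramAlgebra

/-- **Determinant of an `Option`-indexed block-diagonal Gram matrix**: if `Mx` has `Mx none none = 1`,
vanishing mixed entries and `Mx (some i) (some j) = c · N i j`, then `det Mx = c^{card ι} det N`
(reindex by `Option ι ≃ ι ⊕ Unit` and use the block-triangular determinant formula). [folklore] -/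
theorem det_eq_of_option_block {ι : Type*} [Fintype ι] [DecidableEq ι]
    (Mx : Matrix (Option ι) (Option ι) ℝ) (N : Matrix ι ι ℝ) (c : ℝ)
    (hnn : Mx none none = 1) (hns : ∀ i, Mx none (some i) = 0) (hsn : ∀ i, Mx (some i) none = 0)
    (hss : ∀ i j, Mx (some i) (some j) = c * N i j) :
    Mx.det = c ^ Fintype.card ι * N.det := by
  set e := (Equiv.optionEquivSumPUnit.{0} ι).symm with he
  have hsub : Mx.submatrix e e = Matrix.fromBlocks (c • N) 0 0 (1 : Matrix PUnit.{1} PUnit.{1} ℝ) := by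
    ext (i | ⟨⟩) (j | ⟨⟩)
    · simp only [Matrix.submatrix_apply, Matrix.fromBlocks_apply₁₁, he,
        Equiv.optionEquivSumPUnit_symm_inl, hss, Matrix.smul_apply, smul_eq_mul]
    · simp only [Matrix.submatrix_apply, Matrix.fromBlocks_apply₁₂, he,
        Equiv.optionEquivSumPUnit_symm_inl, Equiv.optionEquivSumPUnit_symm_inr, hsn,
        Matrix.zero_apply]
    · simp only [Matrix.submatrix_apply, Matrix.fromBlocks_apply₂₁, he,
        Equiv.optionEquivSumPUnit_symm_inr, Equiv.optionEquivSumPUnit_symm_inl, hns,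
        Matrix.zero_apply]
    · simp only [Matrix.submatrix_apply, Matrix.fromBlocks_apply₂₂, he,
        Equiv.optionEquivSumPUnit_symm_inr, hnn, Matrix.one_apply_eq]
  rw [← Matrix.det_submatrix_equiv_self e Mx, hsub, Matrix.det_fromBlocks_zero₂₁,
    Matrix.det_smul, Matrix.det_one, mul_one]

variable {d : ℕ}


/-- **Gram determinants do not depend on the orthonormal basis**: for a bilinear form `B` on `ℝᵈ`
and an orthonormal family `u : Fin d → ℝᵈ`, `det (B(uᵢ, uⱼ)) = det (B(eᵢ, eⱼ))` for the standard
basis `eᵢ` — the change-of-basis endomorphism `L eᵢ = uᵢ` has `(det L)² = 1` (`det_gram_comp`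
for the inner product, both Gram matrices being the identity), and `det_gram_comp` for `B`.
[folklore] -/
theorem det_gram_eq_of_orthonormal (B : LinearMap.BilinForm ℝ (EuclideanSpace ℝ (Fin d))) {u : Fin d → (EuclideanSpace ℝ (Fin d))}
    (hu : Orthonormal ℝ u) :
    (Matrix.of fun i j ↦ B (u i) (u j)).det =
      (Matrix.of fun i j ↦ B (EuclideanSpace.single i 1) (EuclideanSpace.single j 1)).det := by
  classical
  set b := (EuclideanSpace.basisFun (Fin d) ℝ).toBasis with hb
  have hb_apply : ∀ i, b i = EuclideanSpace.single i 1 := fun i ↦ by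
    rw [hb, OrthonormalBasis.coe_toBasis, EuclideanSpace.basisFun_apply]
  set L : (EuclideanSpace ℝ (Fin d)) →ₗ[ℝ] (EuclideanSpace ℝ (Fin d)) := b.constr ℝ u with hL
  have hLb : ∀ i, L (b i) = u i := fun i ↦ b.constr_basis ℝ u i
  -- `(det L)² = 1` from the inner-product Gram matrices
  have hI : (Matrix.of fun i j ↦ innerₗ (EuclideanSpace ℝ (Fin d)) (L (b i)) (L (b j))).det =
      LinearMap.det L ^ 2 * (Matrix.of fun i j ↦ innerₗ (EuclideanSpace ℝ (Fin d)) (b i) (b j)).det :=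
    det_gram_comp b (innerₗ (EuclideanSpace ℝ (Fin d))) L
  have h1 : (Matrix.of fun i j ↦ innerₗ (EuclideanSpace ℝ (Fin d)) (L (b i)) (L (b j))) = 1 := by
    ext i j
    rw [Matrix.of_apply, hLb, hLb, innerₗ_apply_apply, Matrix.one_apply]
    exact (orthonormal_iff_ite.1 hu) i j
  have h2 : (Matrix.of fun i j ↦ innerₗ (EuclideanSpace ℝ (Fin d)) (b i) (b j)) = 1 := by
    ext i j
    rw [Matrix.of_apply, innerₗ_apply_apply, Matrix.one_apply]
    exact (orthonormal_iff_ite.1 (EuclideanSpace.basisFun (Fin d) ℝ).orthonormal) i j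
  rw [h1, h2, Matrix.det_one, mul_one] at hI
  -- `det_gram_comp` for `B`
  have hB := det_gram_comp b B L
  rw [← hI, one_mul] at hB
  have hlhs : (Matrix.of fun i j ↦ B (u i) (u j)) = Matrix.of fun i j ↦ B (L (b i)) (L (b j)) := by
    ext i j; rw [Matrix.of_apply, Matrix.of_apply, hLb, hLb]
  have hrhs : (Matrix.of fun i j ↦ B (EuclideanSpace.single i 1) (EuclideanSpace.single j 1)) =
      Matrix.of fun i j ↦ B (b i) (b j) := by
    ext i j; rw [Matrix.of_apply, Matrix.of_apply, hb_apply, hb_apply]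
  rw [hlhs, hrhs, hB]

/-- Reindexing a Gram matrix along an equivalence of index types does not change its determinant
(`Matrix.det_submatrix_equiv_self`). [folklore] -/
theorem det_gram_reindex {ι κ : Type*} [Fintype ι] [DecidableEq ι] [Fintype κ] [DecidableEq κ]
    {V : Type*} (B : V → V → ℝ) (u : ι → V) (σ : κ ≃ ι) :
    (Matrix.of fun a b ↦ B (u (σ a)) (u (σ b))).det = (Matrix.of fun i j ↦ B (u i) (u j)).det := by
  have h : (Matrix.of fun a b ↦ B (u (σ a)) (u (σ b))) =
      (Matrix.of fun i j ↦ B (u i) (u j)).submatrix σ σ := by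
    ext a b; rfl
  rw [h, Matrix.det_submatrix_equiv_self]

end GramAlgebra

end Literature.Geometry.Riemannian

/-! ## Part D. The Jacobian of `exp_q` along a ray is `det 𝒜(t)/t^{d-1}` and is non-increasing
under `Ric ≥ 0` -/

namespace Literature.Geometry.Riemannian

open Lorentzian Lorentzian.PseudoRiemannianMetric

section RayJacobian

variable {d : ℕ} {M : Type*} [TopologicalSpace M] [ChartedSpace (EuclideanSpace ℝ (Fin d)) M]
  [IsManifold 𝓘(ℝ, EuclideanSpace ℝ (Fin d)) ∞ M] [T2Space M]
  (g : PseudoRiemannianMetric 𝓘(ℝ, EuclideanSpace ℝ (Fin d)) ∞ (EuclideanSpace ℝ (Fin d))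
    (TangentSpace 𝓘(ℝ, EuclideanSpace ℝ (Fin d)) : M → Type _)) [g.HasLeviCivita]
  [CovariantDerivative.ContMDiffCovariantDerivative g.leviCivita 1]
  [CovariantDerivative.ContMDiffCovariantDerivative g.leviCivita ∞]


omit [CovariantDerivative.ContMDiffCovariantDerivative g.leviCivita 1]
  [CovariantDerivative.ContMDiffCovariantDerivative g.leviCivita ∞] [T2Space M] [g.HasLeviCivita] in
/-- The metric at equal points agrees on tangent vectors read in the model space (all tangent
spaces are the model space `ℝᵈ` definitionally). [folklore] -/
private theorem val_congr_of_eq_point {y y' : M} (h : y = y') (a b : (EuclideanSpace ℝ (Fin d))) :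
    g.val y a b = g.val y' a b := by
  subst h; rfl

omit [T2Space M] [CovariantDerivative.ContMDiffCovariantDerivative g.leviCivita 1]
  [CovariantDerivative.ContMDiffCovariantDerivative g.leviCivita ∞] [g.HasLeviCivita]
  [IsManifold 𝓘(ℝ, EuclideanSpace ℝ (Fin d)) ∞ M] in
/-- Differentials of a map `ℝᵈ → M` at equal points agree (read in the model space). [folklore] -/
private theorem mfderiv_apply_congr_of_eq_point (φ : (EuclideanSpace ℝ (Fin d)) → M) {x x' : (EuclideanSpace ℝ (Fin d))} (h : x = x') (w : (EuclideanSpace ℝ (Fin d))) :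
    (mfderiv 𝓘(ℝ, (EuclideanSpace ℝ (Fin d))) 𝓘(ℝ, (EuclideanSpace ℝ (Fin d))) φ x w : (EuclideanSpace ℝ (Fin d))) = (mfderiv 𝓘(ℝ, (EuclideanSpace ℝ (Fin d))) 𝓘(ℝ, (EuclideanSpace ℝ (Fin d))) φ x' w : (EuclideanSpace ℝ (Fin d))) := by
  subst h; rfl

set_option maxHeartbeats 1600000 in
/-- **The Jacobian of `exp_q` is non-increasing along rays before the first conjugate point, when
`Ric ≥ 0`** — the geometric core of Bishop's volume comparison theorem for `Ric ≥ 0` (Chavel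
2006, Thm. III.4.3 with (III.4.12)–(III.4.13), `κ = 0`; Petersen 2016, Lemma 7.1.2/relative volume
comparison "`λ(r, θ)/λ_k(r, θ)` is nonincreasing"). For a smooth Riemannian metric with complete
Levi-Civita connection and `Ric ≥ 0`, a point `q`, a linear isometry `L : (ℝᵈ, ⟪·,·⟫) ≅ (T_qM, g_q)`
and a unit vector `θ`, write `F = exp_q ∘ L` and
`𝒥(x) = √(det g(dF_x eᵢ, dF_x eⱼ))` (the density of the area formula,
`riemannianMeasure_image_eq_lintegral_of_injOn`). If `d(exp_q)_{t Lθ}` is injective for all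
`t ∈ (0, b)`, then `r ↦ 𝒥(r θ)` is non-increasing on `(0, b)`. Proof: in a parallel orthonormal
frame along `γ_{Lθ}` headed by `γ̇` (`exists_fullFrame_along_maximalGeodesic`), the Gauss-lemma /
Jacobi-field description of `dF_{tθ}` (`normalJacobiTensor_frame_expMap`:
`dF_{tθ} θ = γ̇(t)`, `dF_{tθ} e_k = J_k(t)/t`, `J_k ⊥ γ̇`, `J_k = ∑ A_{ik} eᵢ`) gives
`𝒥(tθ) = det 𝒜(t) / t^{d-1}` (`det_gram_eq_of_orthonormal`, `det_eq_of_option_block`), which is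
non-increasing by the matrix Riccati comparison `jacobi_det_div_pow_antitoneOn`
(`VolumeSphereTheoremProofs.lean`, §8; Chavel 2006, (III.4.12)).
[cite: Chavel2006, §III.4, Thm. III.4.3 ((III.4.12)–(III.4.13), κ = 0)] -/
theorem antitoneOn_jacobian_expMap_ray (hg : g.IsRiemannian)
    (hc : IsGeodesicallyComplete g.leviCivita)
    (hRic : ∀ (x : M) (w : TangentSpace 𝓘(ℝ, (EuclideanSpace ℝ (Fin d))) x), 0 ≤ g.leviCivita.ricci x w w)
    (q : M) (L : (EuclideanSpace ℝ (Fin d)) ≃L[ℝ] (EuclideanSpace ℝ (Fin d))) (hL : ∀ x y : (EuclideanSpace ℝ (Fin d)), g.val q (L x) (L y) = inner ℝ x y)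
    (θ : (EuclideanSpace ℝ (Fin d))) (hθ : ‖θ‖ = 1) {b : ℝ} (hb : 0 < b)
    (hinj : ∀ t ∈ Ioo 0 b, Injective (mfderiv 𝓘(ℝ, (EuclideanSpace ℝ (Fin d))) 𝓘(ℝ, (EuclideanSpace ℝ (Fin d)))
      (fun u : (EuclideanSpace ℝ (Fin d)) ↦ expMap g.leviCivita q (show TangentSpace 𝓘(ℝ, (EuclideanSpace ℝ (Fin d))) q from u))
        (t • (L θ : (EuclideanSpace ℝ (Fin d)))))) :
    AntitoneOn (fun r : ℝ ↦ Real.sqrt (Matrix.of fun i j : Fin d ↦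
      g.val (expMap g.leviCivita q (L (r • θ)))
        (mfderiv 𝓘(ℝ, (EuclideanSpace ℝ (Fin d))) 𝓘(ℝ, (EuclideanSpace ℝ (Fin d))) (fun x : (EuclideanSpace ℝ (Fin d)) ↦ expMap g.leviCivita q (L x)) (r • θ)
          (EuclideanSpace.single i 1))
        (mfderiv 𝓘(ℝ, (EuclideanSpace ℝ (Fin d))) 𝓘(ℝ, (EuclideanSpace ℝ (Fin d))) (fun x : (EuclideanSpace ℝ (Fin d)) ↦ expMap g.leviCivita q (L x)) (r • θ)
          (EuclideanSpace.single j 1))).det) (Ioo 0 b) := by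
  classical
  have hLC := PseudoRiemannianMetric.isLeviCivita_leviCivita_holds (g := g)
  have hreg1 : g.leviCivita.IsLocallyContMDiff 1 :=
    hLC.isLocallyContMDiff_one (WithTop.coe_le_coe.mpr le_top)
  have hinf : g.leviCivita.IsLocallyContMDiff (⊤ : ℕ∞) := hLC.isLocallyContMDiff ⊤ (le_of_eq rfl)
  have h2 : (2 : ℕ∞ω) ≤ (∞ : ℕ∞ω) := WithTop.coe_le_coe.2 le_top
  -- the unit vector `v = L θ`, as an abstract vector of `T_qM = ℝᵈ`
  obtain ⟨v, hvL⟩ : ∃ v : (EuclideanSpace ℝ (Fin d)), v = L θ := ⟨_, rfl⟩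
  have hv : g.val q v v = 1 := by
    rw [hvL, hL θ θ, real_inner_self_eq_norm_sq, hθ, one_pow]
  have hinj' : ∀ t ∈ Ioo 0 b, Injective (mfderiv 𝓘(ℝ, (EuclideanSpace ℝ (Fin d))) 𝓘(ℝ, (EuclideanSpace ℝ (Fin d)))
      (fun u : (EuclideanSpace ℝ (Fin d)) ↦ expMap g.leviCivita q (show TangentSpace 𝓘(ℝ, (EuclideanSpace ℝ (Fin d))) q from u)) (t • v)) := by
    intro t ht
    rw [hvL]
    exact hinj t ht
  obtain ⟨-, hgeo, hγ0, hγv⟩ :=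
    maximalGeodesic_of_isGeodesicallyComplete hc q (show TangentSpace 𝓘(ℝ, (EuclideanSpace ℝ (Fin d))) q from v)
  have h0 : (0 : ℝ) ∈ Ioo (-1 : ℝ) b := ⟨by norm_num, hb⟩
  -- the frame and the normal Jacobi tensor
  obtain ⟨k, f, hfnone, hfpar, hon, hcard⟩ :=
    exists_fullFrame_along_maximalGeodesic g hg hc q (show TangentSpace 𝓘(ℝ, (EuclideanSpace ℝ (Fin d))) q from v) hv h0
  obtain ⟨J, hJ⟩ := normalJacobiTensor_frame_expMap g hreg1 h2 hc q
    (show TangentSpace 𝓘(ℝ, (EuclideanSpace ℝ (Fin d))) q from v) h0 f hfnone hfpar hon hcard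
  obtain ⟨hA, hA', hR, htr, hA0, hA'0, hdet, hJexp, hJnor, hJexpand⟩ := hJ
  have hRc := continuousAt_frameMatrix_curvature g g.leviCivita hreg1 hinf
    (hgeo.mono (subset_univ _)) hfpar h0
  set A : ℝ → Matrix (Fin k) (Fin k) ℝ := fun t ↦ Matrix.of fun i k' ↦
    g.val (maximalGeodesic g.leviCivita q v t) (J k' t) (f t (some i)) with hA_def
  have hdet' : ∀ t ∈ Ioo 0 b, (A t).det ≠ 0 := fun t ht ↦
    hdet t ⟨by linarith [ht.1], ht.2⟩ ht.1.ne' (hinj' t ht)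
  have hpos : ∀ t ∈ Ioo 0 b, 0 < (A t).det := jacobi_det_pos h0 hA hA0 hA'0 hdet'
  -- `exp_q` and `Φ = exp_q ∘ L` as abstract maps `ℝᵈ → M`, and their differentials
  obtain ⟨ex, hex⟩ : ∃ ex : (EuclideanSpace ℝ (Fin d)) → M,
      (fun u : (EuclideanSpace ℝ (Fin d)) ↦ expMap g.leviCivita q (show TangentSpace 𝓘(ℝ, (EuclideanSpace ℝ (Fin d))) q from u)) = ex := ⟨_, rfl⟩
  obtain ⟨Φ, hΦ⟩ : ∃ Φ : (EuclideanSpace ℝ (Fin d)) → M, (fun x : (EuclideanSpace ℝ (Fin d)) ↦ expMap g.leviCivita q (L x)) = Φ := ⟨_, rfl⟩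
  have hΦ_apply : ∀ x : (EuclideanSpace ℝ (Fin d)), expMap g.leviCivita q (L x) = Φ x := fun x ↦ by rw [← hΦ]
  have hex_apply : ∀ u : (EuclideanSpace ℝ (Fin d)), ex u = expMap g.leviCivita q (show TangentSpace 𝓘(ℝ, (EuclideanSpace ℝ (Fin d))) q from u) :=
    fun u ↦ by rw [← hex]
  have hΦex : Φ = ex ∘ (L : (EuclideanSpace ℝ (Fin d)) → (EuclideanSpace ℝ (Fin d))) := by rw [← hΦ, ← hex]; rfl
  have hexs : ContMDiff 𝓘(ℝ, (EuclideanSpace ℝ (Fin d))) 𝓘(ℝ, (EuclideanSpace ℝ (Fin d))) ∞ ex := hex ▸ contMDiff_expMap_infty hc q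
  have hexd : ∀ u, MDifferentiableAt 𝓘(ℝ, (EuclideanSpace ℝ (Fin d))) 𝓘(ℝ, (EuclideanSpace ℝ (Fin d))) ex u := fun u ↦
    (hexs u).mdifferentiableAt (by simp)
  have hdΦ : ∀ x w, (mfderiv 𝓘(ℝ, (EuclideanSpace ℝ (Fin d))) 𝓘(ℝ, (EuclideanSpace ℝ (Fin d))) Φ x w : (EuclideanSpace ℝ (Fin d))) =
      mfderiv 𝓘(ℝ, (EuclideanSpace ℝ (Fin d))) 𝓘(ℝ, (EuclideanSpace ℝ (Fin d))) ex (L x) (L w) := by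
    intro x w
    rw [hΦex, mfderiv_comp x (hexd (L x)) L.mdifferentiableAt, L.mfderiv_eq]
    rfl
  -- dimension bookkeeping: `card (Fin k) + 1 = d`
  have hcardd : Fintype.card (Option (Fin k)) = Fintype.card (Fin d) := by
    rw [hcard, finrank_euclideanSpace_fin, Fintype.card_fin]
  obtain ⟨σ⟩ : Nonempty (Fin d ≃ Option (Fin k)) := ⟨(Fintype.equivOfCardEq hcardd).symm⟩
  -- the `g_q`-orthonormal frame at `q`, pulled back to an orthonormal frame of `ℝᵈ`
  obtain ⟨e', he'⟩ : ∃ e' : Option (Fin k) → (EuclideanSpace ℝ (Fin d)), ∀ o, e' o = L.symm (f 0 o : (EuclideanSpace ℝ (Fin d))) :=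
    ⟨_, fun o ↦ rfl⟩
  have hLe' : ∀ o, (L (e' o) : (EuclideanSpace ℝ (Fin d))) = (f 0 o : (EuclideanSpace ℝ (Fin d))) := fun o ↦ by
    rw [he']; exact L.apply_symm_apply _
  have he'on : Orthonormal ℝ e' := by
    rw [orthonormal_iff_ite]
    intro o o'
    rw [← hL, hLe', hLe', val_congr_of_eq_point g hγ0.symm]
    exact hon 0 h0 o o'
  have he''on : Orthonormal ℝ (e' ∘ σ) := he'on.comp σ σ.injective
  -- THE JACOBIAN IDENTITY along the ray: `𝒥(tθ) = det A(t) / t^k` for `t ∈ (0, b)`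
  have key : ∀ t ∈ Ioo 0 b, Real.sqrt (Matrix.of fun i j : Fin d ↦
      g.val (Φ (t • θ)) (mfderiv 𝓘(ℝ, (EuclideanSpace ℝ (Fin d))) 𝓘(ℝ, (EuclideanSpace ℝ (Fin d))) Φ (t • θ) (EuclideanSpace.single i 1))
        (mfderiv 𝓘(ℝ, (EuclideanSpace ℝ (Fin d))) 𝓘(ℝ, (EuclideanSpace ℝ (Fin d))) Φ (t • θ) (EuclideanSpace.single j 1))).det =
      (A t).det / t ^ k := by
    intro t ht
    have ht0 : t ≠ 0 := ht.1.ne'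
    have htab : t ∈ Ioo (-1 : ℝ) b := ⟨by linarith [ht.1], ht.2⟩
    -- the base point `Φ(tθ) = γ t`
    have hLt : (L (t • θ) : (EuclideanSpace ℝ (Fin d))) = t • v := by rw [map_smul, hvL]
    have hΦt : Φ (t • θ) = maximalGeodesic g.leviCivita q v t := by
      rw [hΦex, Function.comp_apply, hLt, hex_apply]
      exact expMap_smul hc q (show TangentSpace 𝓘(ℝ, (EuclideanSpace ℝ (Fin d))) q from v) t
    -- the metric at `γ t` and the differential of `exp_q` at `t v`, read on `ℝᵈ`
    obtain ⟨G, hG⟩ : ∃ G : (EuclideanSpace ℝ (Fin d)) →L[ℝ] (EuclideanSpace ℝ (Fin d)) →L[ℝ] ℝ, ∀ a b : (EuclideanSpace ℝ (Fin d)),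
        G a b = g.val (maximalGeodesic g.leviCivita q v t) a b :=
      ⟨g.val (maximalGeodesic g.leviCivita q v t), fun a b ↦ rfl⟩
    obtain ⟨D, hD⟩ : ∃ D : (EuclideanSpace ℝ (Fin d)) →L[ℝ] (EuclideanSpace ℝ (Fin d)), ∀ w : (EuclideanSpace ℝ (Fin d)),
        D w = mfderiv 𝓘(ℝ, (EuclideanSpace ℝ (Fin d))) 𝓘(ℝ, (EuclideanSpace ℝ (Fin d))) ex (t • v) w :=
      ⟨mfderiv 𝓘(ℝ, (EuclideanSpace ℝ (Fin d))) 𝓘(ℝ, (EuclideanSpace ℝ (Fin d))) ex (t • v), fun w ↦ rfl⟩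
    have hG1 : ∀ (c : ℝ) (a b : (EuclideanSpace ℝ (Fin d))), G (c • a) b = c * G a b := fun c a b ↦ by
      rw [map_smul, FunLike.coe_smul, Pi.smul_apply, smul_eq_mul]
    have hG2 : ∀ (c : ℝ) (a b : (EuclideanSpace ℝ (Fin d))), G a (c • b) = c * G a b := fun c a b ↦ by
      rw [map_smul, smul_eq_mul]
    have hdΦt : ∀ w, (mfderiv 𝓘(ℝ, (EuclideanSpace ℝ (Fin d))) 𝓘(ℝ, (EuclideanSpace ℝ (Fin d))) Φ (t • θ) w : (EuclideanSpace ℝ (Fin d))) = D (L w) := by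
      intro w
      rw [hdΦ, mfderiv_apply_congr_of_eq_point ex hLt (L w), hD]
    -- the pulled-back metric `B(a, b) = g(dΦ a, dΦ b)` as a bilinear form on `ℝᵈ`
    obtain ⟨B, hB_apply⟩ : ∃ B : LinearMap.BilinForm ℝ (EuclideanSpace ℝ (Fin d)), ∀ a b, B a b = G (D (L a)) (D (L b)) :=
      ⟨LinearMap.mk₂ ℝ (fun a b ↦ G (D (L a)) (D (L b)))
        (fun a₁ a₂ b ↦ by simp only [map_add, FunLike.coe_add, Pi.add_apply])
        (fun c a b ↦ by simp only [map_smul, FunLike.coe_smul, Pi.smul_apply, smul_eq_mul])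
        (fun a b₁ b₂ ↦ by simp only [map_add])
        (fun c a b ↦ by simp only [map_smul, smul_eq_mul]), fun a b ↦ rfl⟩
    have hmat : (Matrix.of fun i j : Fin d ↦
        g.val (Φ (t • θ)) (mfderiv 𝓘(ℝ, (EuclideanSpace ℝ (Fin d))) 𝓘(ℝ, (EuclideanSpace ℝ (Fin d))) Φ (t • θ) (EuclideanSpace.single i 1))
          (mfderiv 𝓘(ℝ, (EuclideanSpace ℝ (Fin d))) 𝓘(ℝ, (EuclideanSpace ℝ (Fin d))) Φ (t • θ) (EuclideanSpace.single j 1))) =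
        Matrix.of fun i j : Fin d ↦ B (EuclideanSpace.single i 1) (EuclideanSpace.single j 1) := by
      ext i j
      rw [Matrix.of_apply, Matrix.of_apply, hB_apply, val_congr_of_eq_point g hΦt, hdΦt, hdΦt, hG]
    -- the differential on the frame: `D v = γ̇(t)`, `D e_i(0) = t⁻¹ J_i(t)`
    have hDv : D v = (velocity 𝓘(ℝ, (EuclideanSpace ℝ (Fin d))) (maximalGeodesic g.leviCivita q v) t : (EuclideanSpace ℝ (Fin d))) := by
      have h1 := velocity_comp_lineAt_zero (I := 𝓘(ℝ, (EuclideanSpace ℝ (Fin d)))) (hexd (t • v)) v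
      have hcurve : (fun s : ℝ ↦ ex (t • v + s • v)) =
          fun s ↦ maximalGeodesic g.leviCivita q v (1 * s + t) := by
        funext s
        rw [← add_smul, one_mul, add_comm s t, hex_apply]
        exact expMap_smul hc q (show TangentSpace 𝓘(ℝ, (EuclideanSpace ℝ (Fin d))) q from v) (t + s)
      rw [hD, ← h1, hcurve, velocity_comp_affine (maximalGeodesic g.leviCivita q v) 1 t 0, one_smul,
        one_mul, zero_add]
    have hDw : ∀ i, D (f 0 (some i)) = t⁻¹ • (show (EuclideanSpace ℝ (Fin d)) from J i t) := by
      intro i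
      have h1 : (show (EuclideanSpace ℝ (Fin d)) from J i t) = D (t • (show (EuclideanSpace ℝ (Fin d)) from f 0 (some i))) := by
        rw [hD, ← hex]; exact hJexp i t
      show D (show (EuclideanSpace ℝ (Fin d)) from f 0 (some i)) = _
      rw [h1, map_smul, smul_smul, inv_mul_cancel₀ ht0, one_smul]
    have hf0none : (f 0 none : (EuclideanSpace ℝ (Fin d))) = v := by rw [hfnone 0]; exact hγv
    -- the entries of the Gram matrix in the adapted frame
    have hvv : G (velocity 𝓘(ℝ, (EuclideanSpace ℝ (Fin d))) (maximalGeodesic g.leviCivita q v) t : (EuclideanSpace ℝ (Fin d)))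
        (velocity 𝓘(ℝ, (EuclideanSpace ℝ (Fin d))) (maximalGeodesic g.leviCivita q v) t : (EuclideanSpace ℝ (Fin d))) = 1 := by
      rw [hG]
      have h := hon t htab none none
      rw [hfnone t] at h
      simpa using h
    have hvJ : ∀ i, G (velocity 𝓘(ℝ, (EuclideanSpace ℝ (Fin d))) (maximalGeodesic g.leviCivita q v) t : (EuclideanSpace ℝ (Fin d)))
        (show (EuclideanSpace ℝ (Fin d)) from J i t) = 0 := by
      intro i
      rw [hG, g.symm]
      exact hJnor i t
    have hJv : ∀ i, G (show (EuclideanSpace ℝ (Fin d)) from J i t)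
        (velocity 𝓘(ℝ, (EuclideanSpace ℝ (Fin d))) (maximalGeodesic g.leviCivita q v) t : (EuclideanSpace ℝ (Fin d))) = 0 := by
      intro i
      rw [hG]
      exact hJnor i t
    have hJJ : ∀ i j, G (show (EuclideanSpace ℝ (Fin d)) from J i t) (show (EuclideanSpace ℝ (Fin d)) from J j t) = ∑ l, A t l i * A t l j := by
      intro i j
      rw [hG]
      show g.val (maximalGeodesic g.leviCivita q v t) (J i t) (J j t) = _
      conv_lhs => rw [hJexpand t htab i, hJexpand t htab j]
      simp only [_root_.map_sum, map_smul, FunLike.coe_sum, FunLike.coe_smul, Finset.sum_apply,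
        Pi.smul_apply, smul_eq_mul, hon t htab, Option.some.injEq, mul_ite, mul_one,
        mul_zero, Finset.sum_ite_eq', Finset.mem_univ, if_true]
      exact Finset.sum_congr rfl fun l _ ↦ mul_comm _ _
    -- the Gram matrix in the adapted frame is block diagonal
    have hblock : (Matrix.of fun o o' ↦ B (e' o) (e' o')).det =
        (t⁻¹ * t⁻¹) ^ Fintype.card (Fin k) * ((A t).transpose * A t).det := by
      refine det_eq_of_option_block _ ((A t).transpose * A t) (t⁻¹ * t⁻¹) ?_ ?_ ?_ ?_
      · rw [Matrix.of_apply, hB_apply, hLe', hf0none, hDv, hvv]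
      · intro i
        rw [Matrix.of_apply, hB_apply, hLe', hLe', hf0none, hDv, hDw, hG2, hvJ, mul_zero]
      · intro i
        rw [Matrix.of_apply, hB_apply, hLe', hLe', hf0none, hDv, hDw, hG1, hJv, mul_zero]
      · intro i j
        rw [Matrix.of_apply, hB_apply, hLe', hLe', hDw, hDw, hG1, hG2, hJJ, Matrix.mul_apply,
          ← mul_assoc]
        rfl
    -- assembling: `det = t^{-2k} (det A)²`
    have hdet2 : (Matrix.of fun i j : Fin d ↦
        g.val (Φ (t • θ)) (mfderiv 𝓘(ℝ, (EuclideanSpace ℝ (Fin d))) 𝓘(ℝ, (EuclideanSpace ℝ (Fin d))) Φ (t • θ) (EuclideanSpace.single i 1))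
          (mfderiv 𝓘(ℝ, (EuclideanSpace ℝ (Fin d))) 𝓘(ℝ, (EuclideanSpace ℝ (Fin d))) Φ (t • θ) (EuclideanSpace.single j 1))).det =
        ((A t).det / t ^ k) ^ 2 := by
      rw [hmat, ← det_gram_eq_of_orthonormal B he''on]
      have hre : (Matrix.of fun a b : Fin d ↦ B ((e' ∘ σ) a) ((e' ∘ σ) b)).det =
          (Matrix.of fun o o' ↦ B (e' o) (e' o')).det :=
        det_gram_reindex (fun a b ↦ B a b) e' σ
      rw [hre, hblock, Matrix.det_mul, Matrix.det_transpose, Fintype.card_fin]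
      ring
    rw [hdet2, Real.sqrt_sq (div_nonneg (hpos t ht).le (pow_nonneg ht.1.le _))]
  -- conclusion: `det A(t)/t^k` is non-increasing (matrix Riccati comparison, `Ric ≥ 0`)
  intro s hs t ht hst
  simp only []
  rw [hΦ, hΦ_apply, hΦ_apply, key s hs, key t ht]
  rcases isEmpty_or_nonempty (Fin k) with hk | hk
  · have hk0 : k = 0 := by
      have h1 : Fintype.card (Fin k) = 0 := Fintype.card_eq_zero_iff.2 hk
      rwa [Fintype.card_fin] at h1
    subst hk0
    simp [Matrix.det_isEmpty]
  · have hRic' : ∀ t ∈ Ioo 0 b, 0 ≤ (Matrix.of fun i j ↦ g.val (maximalGeodesic g.leviCivita q v t)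
        (g.leviCivita.curvature (maximalGeodesic g.leviCivita q v t) (f t (some j))
          (velocity 𝓘(ℝ, (EuclideanSpace ℝ (Fin d))) (maximalGeodesic g.leviCivita q v) t)
          (velocity 𝓘(ℝ, (EuclideanSpace ℝ (Fin d))) (maximalGeodesic g.leviCivita q v) t)) (f t (some i))).trace := by
      intro t ht
      rw [htr t ⟨by linarith [ht.1], ht.2⟩]
      exact hRic _ _
    have hanti := jacobi_det_div_pow_antitoneOn h0 hA hA' hR hRc hA0 hA'0 hdet' hRic'
    have h := hanti hs ht hst
    simp only [Fintype.card_fin] at h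
    exact h

end RayJacobian

end Literature.Geometry.Riemannian

/-! ## Part E. Polar coordinates on `ℝᵈ`, ray-null sets, and Gromov's one-variable inequality -/

namespace Literature.Geometry.Riemannian

section Polar

variable {d : ℕ}


/-- **Integration in polar coordinates on `ℝᵈ`** (`d ≥ 1`): for measurable `f : ℝᵈ → [0, ∞]`,
`∫ f dx = ∫_{S^{d-1}} ∫₀^∞ f(rθ) r^{d-1} dr dσ(θ)`, with `σ = volume.toSphere` Mathlib's measure on
the unit sphere (Chavel 2006, (III.3.5) in the flat case; Mathlib's
`measurePreserving_homeomorphUnitSphereProd`). [folklore] -/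
theorem lintegral_eq_lintegral_sphere_Ioi (hd : 0 < d) (f : (EuclideanSpace ℝ (Fin d)) → ℝ≥0∞) (hf : Measurable f) :
    ∫⁻ x, f x ∂volume = ∫⁻ θ : Metric.sphere (0 : (EuclideanSpace ℝ (Fin d))) 1,
      ∫⁻ r in Ioi (0 : ℝ), f (r • (θ : (EuclideanSpace ℝ (Fin d)))) * ENNReal.ofReal (r ^ (d - 1)) ∂volume
        ∂(volume : Measure (EuclideanSpace ℝ (Fin d))).toSphere := by
  haveI : Nontrivial (EuclideanSpace ℝ (Fin d)) := by
    have : 0 < Module.finrank ℝ (EuclideanSpace ℝ (Fin d)) := by rw [finrank_euclideanSpace_fin]; exact hd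
    exact Module.finrank_pos_iff.1 this
  -- remove the origin and pass to `sphere × (0, ∞)`
  have h1 : ∫⁻ x, f x ∂volume = ∫⁻ x in ({0}ᶜ : Set (EuclideanSpace ℝ (Fin d))), f x ∂volume := by
    rw [restrict_compl_singleton]
  have h2 : ∫⁻ x in ({0}ᶜ : Set (EuclideanSpace ℝ (Fin d))), f x ∂volume =
      ∫⁻ x : ({0}ᶜ : Set (EuclideanSpace ℝ (Fin d))), f x ∂(Measure.comap Subtype.val volume) :=
    (lintegral_subtype_comap (measurableSet_singleton (0 : (EuclideanSpace ℝ (Fin d)))).compl f).symm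
  set G : Metric.sphere (0 : (EuclideanSpace ℝ (Fin d))) 1 × Ioi (0 : ℝ) → ℝ≥0∞ := fun p ↦ f ((p.2 : ℝ) • (p.1 : (EuclideanSpace ℝ (Fin d)))) with hG
  have hGm : Measurable G :=
    hf.comp ((continuous_subtype_val.comp continuous_snd).smul
      (continuous_subtype_val.comp continuous_fst)).measurable
  have h3 : ∀ x : ({0}ᶜ : Set (EuclideanSpace ℝ (Fin d))), f x = G (homeomorphUnitSphereProd (EuclideanSpace ℝ (Fin d)) x) := by
    intro x
    simp only [hG]
    rw [← homeomorphUnitSphereProd_symm_apply_coe, Homeomorph.symm_apply_apply]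
  have hmp := Measure.measurePreserving_homeomorphUnitSphereProd (volume : Measure (EuclideanSpace ℝ (Fin d)))
  rw [h1, h2]
  simp_rw [h3]
  rw [hmp.lintegral_comp_emb (Homeomorph.measurableEmbedding _) G,
    lintegral_prod _ hGm.aemeasurable]
  refine lintegral_congr fun θ ↦ ?_
  rw [finrank_euclideanSpace_fin]
  simp only [hG, Measure.volumeIoiPow]
  rw [lintegral_withDensity_eq_lintegral_mul _
    (by exact ENNReal.measurable_ofReal.comp ((continuous_subtype_val.pow _).measurable))
    (by exact hf.comp ((continuous_subtype_val.smul continuous_const).measurable))]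
  have h4 := lintegral_subtype_comap (μ := (volume : Measure ℝ))
    (measurableSet_Ioi : MeasurableSet (Ioi (0 : ℝ)))
    (fun r : ℝ ↦ ENNReal.ofReal (r ^ (d - 1)) * f (r • (θ : (EuclideanSpace ℝ (Fin d)))))
  beta_reduce at h4
  simp only [Pi.mul_apply]
  rw [h4]
  exact lintegral_congr fun r ↦ mul_comm _ _

/-- **A measurable set meeting each open ray from the origin in at most one point is Lebesgue-null**
(polar coordinates and Tonelli: every ray section has Lebesgue measure zero on `(0, ∞)`).
[folklore] -/
theorem volume_eq_zero_of_subsingleton_ray (hd : 0 < d) {N : Set (EuclideanSpace ℝ (Fin d))} (hN : MeasurableSet N)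
    (hray : ∀ θ : (EuclideanSpace ℝ (Fin d)), ‖θ‖ = 1 → {r : ℝ | 0 < r ∧ r • θ ∈ N}.Subsingleton) : volume N = 0 := by
  rw [← lintegral_indicator_one hN,
    lintegral_eq_lintegral_sphere_Ioi hd (N.indicator 1) (measurable_one.indicator hN)]
  have hinner : ∀ θ : Metric.sphere (0 : (EuclideanSpace ℝ (Fin d))) 1,
      ∫⁻ r in Ioi (0 : ℝ), N.indicator 1 (r • (θ : (EuclideanSpace ℝ (Fin d)))) * ENNReal.ofReal (r ^ (d - 1)) ∂volume
        = 0 := by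
    intro θ
    have hθ : ‖(θ : (EuclideanSpace ℝ (Fin d)))‖ = 1 := mem_sphere_zero_iff_norm.1 θ.2
    have hS0 : volume {r : ℝ | 0 < r ∧ r • (θ : (EuclideanSpace ℝ (Fin d))) ∈ N} = 0 := (hray _ hθ).measure_zero volume
    have hae : ∀ᵐ r ∂(volume.restrict (Ioi (0 : ℝ))),
        N.indicator 1 (r • (θ : (EuclideanSpace ℝ (Fin d)))) * ENNReal.ofReal (r ^ (d - 1)) = (0 : ℝ → ℝ≥0∞) r := by
      filter_upwards [ae_restrict_mem measurableSet_Ioi,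
        ae_restrict_of_ae (measure_eq_zero_iff_ae_notMem.1 hS0)] with r hr hrS
      have hrN : r • (θ : (EuclideanSpace ℝ (Fin d))) ∉ N := fun h ↦ hrS ⟨hr, h⟩
      simp [Set.indicator_of_notMem hrN]
    rw [lintegral_congr_ae hae]
    simp
  simp only [hinner, lintegral_zero]

/-- **Gromov's one-variable inequality, `Ric ≥ 0` model** (the annular form of the Bishop–Gromov
ratio comparison in polar data; Chavel 2006, Lemma III.4.1 / Prop. III.4.1 with `g(t) = t^{d-1}`;
Zhu 1997, Lemma 3.2; cf. `integral_setIntegral_annulus_mul_le` of `VolumeSphereTheoremProofs.lean`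
for real integrals): if `φ : ℝ → [0, ∞]` is non-increasing on `(0, ∞)` then for `0 < a ≤ b`,
`∫_{[a,b)} φ(r) r^k dr ≤ ((b^{k+1} - a^{k+1})/a^{k+1}) ∫_{(0,a)} φ(r) r^k dr`: for `r ≥ a`,
`φ(r) a^{k+1}/(k+1) = ∫₀ᵃ φ(r) s^k ds ≤ ∫₀ᵃ φ(s) s^k ds`. [cite: Chavel2006, §III.4, Lemma III.4.1] -/
theorem setLIntegral_Ico_mul_pow_le (φ : ℝ → ℝ≥0∞)
    (hanti : ∀ ⦃s r : ℝ⦄, 0 < s → s ≤ r → φ r ≤ φ s) (k : ℕ) {a b : ℝ} (ha : 0 < a) (hab : a ≤ b) :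
    ∫⁻ r in Ico a b, φ r * ENNReal.ofReal (r ^ k) ∂volume ≤
      ENNReal.ofReal ((b ^ (k + 1) - a ^ (k + 1)) / a ^ (k + 1)) *
        ∫⁻ r in Ioo 0 a, φ r * ENNReal.ofReal (r ^ k) ∂volume := by
  set I₀ := ∫⁻ r in Ioo 0 a, φ r * ENNReal.ofReal (r ^ k) ∂volume with hI₀
  have hk1 : (0 : ℝ) < k + 1 := by positivity
  have hak : 0 < a ^ (k + 1) := pow_pos ha _
  have hmeas : Measurable fun r : ℝ ↦ ENNReal.ofReal (r ^ k) :=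
    ENNReal.measurable_ofReal.comp (continuous_id.pow k).measurable
  -- `∫_{(0,a)} s^k = a^{k+1}/(k+1)` and `∫_{[a,b)} r^k = (b^{k+1} - a^{k+1})/(k+1)`
  have hpow : ∀ {u w : ℝ}, 0 ≤ u → u ≤ w →
      ∫⁻ r in Ioc u w, ENNReal.ofReal (r ^ k) ∂volume =
        ENNReal.ofReal ((w ^ (k + 1) - u ^ (k + 1)) / (k + 1)) := by
    intro u w hu huw
    rw [← ofReal_integral_eq_lintegral_ofReal]
    · rw [← intervalIntegral.integral_of_le huw, integral_pow]
    · exact (intervalIntegral.intervalIntegrable_pow (μ := volume) (a := u) (b := w) k).1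
    · exact ae_restrict_of_forall_mem measurableSet_Ioc fun r hr ↦ pow_nonneg (hu.trans hr.1.le) _
  have hIoo : ∫⁻ r in Ioo 0 a, ENNReal.ofReal (r ^ k) ∂volume =
      ENNReal.ofReal (a ^ (k + 1) / (k + 1)) := by
    rw [Measure.restrict_congr_set Ioo_ae_eq_Ioc, hpow le_rfl ha.le, zero_pow (Nat.succ_ne_zero k),
      sub_zero]
  have hIco : ∫⁻ r in Ico a b, ENNReal.ofReal (r ^ k) ∂volume =
      ENNReal.ofReal ((b ^ (k + 1) - a ^ (k + 1)) / (k + 1)) := by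
    rw [Measure.restrict_congr_set Ico_ae_eq_Ioc, hpow ha.le hab]
  -- the pointwise bound `φ r · a^{k+1}/(k+1) ≤ I₀` for `r ≥ a`
  have hpt : ∀ r, a ≤ r → φ r * ENNReal.ofReal (a ^ (k + 1) / (k + 1)) ≤ I₀ := by
    intro r hr
    rw [← hIoo, ← lintegral_const_mul _ hmeas]
    refine lintegral_mono_ae (ae_restrict_of_forall_mem measurableSet_Ioo fun s hs ↦ ?_)
    exact mul_le_mul' (hanti hs.1 (hs.2.le.trans hr)) le_rfl
  -- hence `φ r ≤ I₀ · (k+1)/a^{k+1}` on `[a, b)`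
  have hC0 : ENNReal.ofReal (a ^ (k + 1) / (k + 1)) ≠ 0 :=
    (ENNReal.ofReal_pos.2 (div_pos hak hk1)).ne'
  have hpt' : ∀ r, a ≤ r → φ r ≤ I₀ * ENNReal.ofReal ((k + 1) / a ^ (k + 1)) := by
    intro r hr
    have h1 : φ r ≤ I₀ / ENNReal.ofReal (a ^ (k + 1) / (k + 1)) :=
      (ENNReal.le_div_iff_mul_le (Or.inl hC0) (Or.inl ENNReal.ofReal_ne_top)).2 (hpt r hr)
    rwa [div_eq_mul_inv, ← ENNReal.ofReal_inv_of_pos (div_pos hak hk1), inv_div] at h1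
  calc ∫⁻ r in Ico a b, φ r * ENNReal.ofReal (r ^ k) ∂volume
      ≤ ∫⁻ r in Ico a b, (I₀ * ENNReal.ofReal ((k + 1) / a ^ (k + 1))) * ENNReal.ofReal (r ^ k)
          ∂volume := by
        refine lintegral_mono_ae (ae_restrict_of_forall_mem measurableSet_Ico fun r hr ↦ ?_)
        exact mul_le_mul' (hpt' r hr.1) le_rfl
    _ = I₀ * (ENNReal.ofReal ((k + 1) / a ^ (k + 1)) *
          ENNReal.ofReal ((b ^ (k + 1) - a ^ (k + 1)) / (k + 1))) := by
        rw [lintegral_const_mul _ hmeas, hIco, mul_assoc]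
    _ = ENNReal.ofReal ((b ^ (k + 1) - a ^ (k + 1)) / a ^ (k + 1)) * I₀ := by
        rw [← ENNReal.ofReal_mul (div_pos hk1 hak).le, mul_comm I₀]
        congr 2
        field_simp

/-- `‖r θ‖ = r` for a unit vector `θ` and `r > 0`. [folklore] -/
theorem norm_smul_of_norm_eq_one {θ : (EuclideanSpace ℝ (Fin d))} (hθ : ‖θ‖ = 1) {r : ℝ} (hr : 0 < r) : ‖r • θ‖ = r := by
  rw [norm_smul, Real.norm_eq_abs, abs_of_pos hr, hθ, mul_one]

/-- **Gromov's inequality between a shell and a ball, `Ric ≥ 0` model, for radially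
non-increasing densities** (the annular Bishop–Gromov inequality in polar coordinates; Chow et
al. 2007, App. A, Cor. A.4 / (2.118); Chavel 2006, §III.4): if `Ψ : ℝᵈ → [0, ∞]` (`d ≥ 1`) is
measurable and non-increasing along each ray from the origin, then for `0 < a ≤ b`,
`∫_{a ≤ |x| < b} Ψ ≤ ((b^d - a^d)/a^d) ∫_{|x| < a} Ψ` (polar coordinates
`lintegral_eq_lintegral_sphere_Ioi` and `setLIntegral_Ico_mul_pow_le` on each ray).
[cite: Chavel2006, §III.4, Lemma III.4.1] -/
theorem setLIntegral_shell_le_mul_setLIntegral_ball (hd : 0 < d) {Ψ : (EuclideanSpace ℝ (Fin d)) → ℝ≥0∞}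
    (hΨ : Measurable Ψ)
    (hanti : ∀ θ : (EuclideanSpace ℝ (Fin d)), ‖θ‖ = 1 → ∀ ⦃s r : ℝ⦄, 0 < s → s ≤ r → Ψ (r • θ) ≤ Ψ (s • θ))
    {a b : ℝ} (ha : 0 < a) (hab : a ≤ b) :
    ∫⁻ x in {x : (EuclideanSpace ℝ (Fin d)) | a ≤ ‖x‖ ∧ ‖x‖ < b}, Ψ x ∂volume ≤
      ENNReal.ofReal ((b ^ d - a ^ d) / a ^ d) * ∫⁻ x in Metric.ball (0 : (EuclideanSpace ℝ (Fin d))) a, Ψ x ∂volume := by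
  have hSh : MeasurableSet {x : (EuclideanSpace ℝ (Fin d)) | a ≤ ‖x‖ ∧ ‖x‖ < b} :=
    (measurableSet_le measurable_const measurable_norm).inter
      (measurableSet_lt measurable_norm measurable_const)
  rw [← lintegral_indicator hSh Ψ, ← lintegral_indicator measurableSet_ball Ψ,
    lintegral_eq_lintegral_sphere_Ioi hd _ (hΨ.indicator hSh),
    lintegral_eq_lintegral_sphere_Ioi hd _ (hΨ.indicator measurableSet_ball),
    ← lintegral_const_mul' _ _ ENNReal.ofReal_ne_top]
  refine lintegral_mono fun θ ↦ ?_
  have hθ : ‖(θ : (EuclideanSpace ℝ (Fin d)))‖ = 1 := mem_sphere_zero_iff_norm.1 θ.2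
  -- radial sections of the shell and of the ball
  have h1 : ∫⁻ r in Ioi (0 : ℝ), {x : (EuclideanSpace ℝ (Fin d)) | a ≤ ‖x‖ ∧ ‖x‖ < b}.indicator Ψ (r • (θ : (EuclideanSpace ℝ (Fin d)))) *
      ENNReal.ofReal (r ^ (d - 1)) ∂volume =
      ∫⁻ r in Ico a b, Ψ (r • (θ : (EuclideanSpace ℝ (Fin d)))) * ENNReal.ofReal (r ^ (d - 1)) ∂volume := by
    rw [setLIntegral_congr_fun measurableSet_Ioi (g := (Ico a b).indicator fun r ↦
      Ψ (r • (θ : (EuclideanSpace ℝ (Fin d)))) * ENNReal.ofReal (r ^ (d - 1))) ?_, lintegral_indicator measurableSet_Ico,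
      Measure.restrict_restrict measurableSet_Ico,
      inter_eq_left.2 (show Ico a b ⊆ Ioi (0 : ℝ) from fun r hr ↦ ha.trans_le hr.1)]
    intro r hr
    beta_reduce
    have hnr : ‖r • (θ : (EuclideanSpace ℝ (Fin d)))‖ = r := norm_smul_of_norm_eq_one hθ hr
    by_cases h : a ≤ r ∧ r < b
    · rw [indicator_of_mem (show r • (θ : (EuclideanSpace ℝ (Fin d))) ∈ {x : (EuclideanSpace ℝ (Fin d)) | a ≤ ‖x‖ ∧ ‖x‖ < b} by
        simpa [hnr] using h), indicator_of_mem (show r ∈ Ico a b from h)]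
    · rw [indicator_of_notMem (show r • (θ : (EuclideanSpace ℝ (Fin d))) ∉ {x : (EuclideanSpace ℝ (Fin d)) | a ≤ ‖x‖ ∧ ‖x‖ < b} by
        simpa [hnr] using h), indicator_of_notMem (show r ∉ Ico a b from h), zero_mul]
  have h2 : ∫⁻ r in Ioi (0 : ℝ), (Metric.ball (0 : (EuclideanSpace ℝ (Fin d))) a).indicator Ψ (r • (θ : (EuclideanSpace ℝ (Fin d)))) *
      ENNReal.ofReal (r ^ (d - 1)) ∂volume =
      ∫⁻ r in Ioo 0 a, Ψ (r • (θ : (EuclideanSpace ℝ (Fin d)))) * ENNReal.ofReal (r ^ (d - 1)) ∂volume := by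
    rw [setLIntegral_congr_fun measurableSet_Ioi (g := (Iio a).indicator fun r ↦
      Ψ (r • (θ : (EuclideanSpace ℝ (Fin d)))) * ENNReal.ofReal (r ^ (d - 1))) ?_, lintegral_indicator measurableSet_Iio,
      Measure.restrict_restrict measurableSet_Iio, Iio_inter_Ioi]
    intro r hr
    beta_reduce
    have hnr : ‖r • (θ : (EuclideanSpace ℝ (Fin d)))‖ = r := norm_smul_of_norm_eq_one hθ hr
    by_cases h : r < a
    · rw [indicator_of_mem (show r • (θ : (EuclideanSpace ℝ (Fin d))) ∈ Metric.ball (0 : (EuclideanSpace ℝ (Fin d))) a by simpa [hnr] using h),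
        indicator_of_mem (show r ∈ Iio a from h)]
    · rw [indicator_of_notMem (show r • (θ : (EuclideanSpace ℝ (Fin d))) ∉ Metric.ball (0 : (EuclideanSpace ℝ (Fin d))) a by simpa [hnr] using h),
        indicator_of_notMem (show r ∉ Iio a from h), zero_mul]
  rw [h1, h2]
  have key := setLIntegral_Ico_mul_pow_le (fun r ↦ Ψ (r • (θ : (EuclideanSpace ℝ (Fin d))))) (hanti θ hθ) (d - 1) ha hab
  rwa [Nat.sub_add_cancel hd] at key

/-- **A set star-shaped about the origin meets each open ray in at most one "last" point**: if
`W ⊆ ℝᵈ` is invariant under `x ↦ s x` for `0 < s ≤ 1`, then the set of points outside `W` all of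
whose contractions `(1 - 1/(m+2)) x`, `m ∈ ℕ`, lie in `W` meets each ray `{r θ : r > 0}` in at
most one point. [folklore] -/
theorem subsingleton_ray_of_star {W : Set (EuclideanSpace ℝ (Fin d))}
    (hstar : ∀ x ∈ W, ∀ s : ℝ, 0 < s → s ≤ 1 → s • x ∈ W) (θ : (EuclideanSpace ℝ (Fin d))) :
    {r : ℝ | 0 < r ∧ r • θ ∈
      Wᶜ ∩ ⋂ m : ℕ, (fun x : (EuclideanSpace ℝ (Fin d)) ↦ (1 - 1 / ((m : ℝ) + 2)) • x) ⁻¹' W}.Subsingleton := by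
  -- the key asymmetric statement
  have key : ∀ r₁ r₂ : ℝ, 0 < r₁ → r₁ < r₂ → r₁ • θ ∉ W →
      r₂ • θ ∈ ⋂ m : ℕ, (fun x : (EuclideanSpace ℝ (Fin d)) ↦ (1 - 1 / ((m : ℝ) + 2)) • x) ⁻¹' W → False := by
    intro r₁ r₂ h₁ h12 hnot hall
    have h₂ : 0 < r₂ := h₁.trans h12
    set t : ℝ := r₁ / r₂ with ht
    have ht0 : 0 < t := div_pos h₁ h₂
    have ht1 : t < 1 := (div_lt_one h₂).2 h12
    obtain ⟨m, hm⟩ := exists_nat_gt (1 / (1 - t))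
    have hm2 : (0 : ℝ) < (m : ℝ) + 2 := by positivity
    have hcm : 1 / ((m : ℝ) + 2) < 1 - t :=
      (one_div_lt hm2 (by linarith)).2 (by linarith)
    set c : ℝ := 1 - 1 / ((m : ℝ) + 2) with hc
    have hct : t < c := by rw [hc]; linarith
    have hc0 : 0 < c := ht0.trans hct
    have hmem : c • (r₂ • θ) ∈ W := by
      have := mem_iInter.1 hall m
      exact this
    set s : ℝ := r₁ / (c * r₂) with hs
    have hs0 : 0 < s := div_pos h₁ (mul_pos hc0 h₂)
    have hs1 : s ≤ 1 := by
      rw [hs, div_le_one (mul_pos hc0 h₂)]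
      have : t * r₂ = r₁ := by rw [ht, div_mul_cancel₀ r₁ h₂.ne']
      nlinarith
    have h := hstar _ hmem s hs0 hs1
    rw [smul_smul, smul_smul, show s * c * r₂ = r₁ by
      rw [hs]; field_simp] at h
    exact hnot h
  intro r₁ hr₁ r₂ hr₂
  by_contra hne
  rcases lt_or_gt_of_ne hne with h | h
  · exact key r₁ r₂ hr₁.1 h hr₁.2.1 hr₂.2.2
  · exact key r₂ r₁ hr₂.1 h hr₂.2.1 hr₁.2.2

/-- The "last points" set of `subsingleton_ray_of_star` is measurable when `W` is open.
[folklore] -/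
theorem measurableSet_compl_inter_iInter_preimage_smul {W : Set (EuclideanSpace ℝ (Fin d))} (hW : IsOpen W) :
    MeasurableSet (Wᶜ ∩ ⋂ m : ℕ, (fun x : (EuclideanSpace ℝ (Fin d)) ↦ (1 - 1 / ((m : ℝ) + 2)) • x) ⁻¹' W) :=
  hW.measurableSet.compl.inter
    (MeasurableSet.iInter fun _ ↦ (hW.preimage (continuous_const_smul _)).measurableSet)

end Polar

end Literature.Geometry.Riemannian

/-! ## Part F. The injectivity domain on complete manifolds, polar representation of points, and
the assembly of Yau's argument -/

namespace Literature.Geometry.Riemannian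

open Lorentzian Lorentzian.PseudoRiemannianMetric

section CompleteID

variable {E : Type*} [NormedAddCommGroup E] [NormedSpace ℝ E] {H : Type*} [TopologicalSpace H]
  {I : ModelWithCorners ℝ E H} {M : Type*} [TopologicalSpace M] [ChartedSpace H M]
  [IsManifold I ∞ M] {n : ℕ∞ω} [FiniteDimensional ℝ E] [CompleteSpace E] [T2Space M]
  [BoundarylessManifold I M]
  (g : PseudoRiemannianMetric I n E (TangentSpace I : M → Type _)) [g.HasLeviCivita]
  [CovariantDerivative.ContMDiffCovariantDerivative g.leviCivita 1]

/-- **The injectivity domain `ID(p)` is open in `T_pM` on a complete manifold** (Lee 2018,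
Thm. 10.34 (a), stated there for complete manifolds): the proof of the tree's
`isOpen_injectivityDomain` (`InjectivityDomainOpen.lean`, written for compact `M`) uses
compactness only through geodesic completeness (`hopfRinow_compact_geodesicallyComplete`); it is
repeated here verbatim with completeness as the hypothesis — lower semicontinuity of the cut time
(`cutTime_le_of_tendsto`) and its uniform positivity near `0` (`exists_pos_le_cutTime`).
[cite: LeeRiemannianManifolds2018, Thm. 10.34 (a)] -/
theorem isOpen_injectivityDomain_of_isGeodesicallyComplete [ConnectedSpace M] (hn : (∞ : ℕ∞ω) ≤ n)
    (hg : g.IsRiemannian) (hc : IsGeodesicallyComplete g.leviCivita) (p : M) :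
    IsOpen {w : E | (show TangentSpace I p from w) ∈ injectivityDomain g hg p} := by
  haveI : Fact (1 ≤ n) := ⟨le_trans (by exact_mod_cast le_top) hn⟩
  set S : Set E := {w : E | (show TangentSpace I p from w) ∈ injectivityDomain g hg p} with hS
  set G : E →L[ℝ] E →L[ℝ] ℝ := g.val p with hG
  have hGcont : Continuous fun u : E ↦ G u u := G.continuous₂.comp (continuous_id.prodMk continuous_id)
  have hID : ∀ (u : E) (s : ℝ), 1 < s → IsMinimizingUpTo g hg p (show TangentSpace I p from u) s →
      Injective (mfderiv 𝓘(ℝ, E) I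
        (fun w : E ↦ riemannianExpMap g p (show TangentSpace I p from w)) u) :=
    fun u s hs hmin ↦
      mfderiv_riemannianExpMap_injective_of_mem_injectivityDomain g hn hg hc p ⟨s, hs, hmin⟩
  obtain ⟨ε, hε, hεcut⟩ := exists_pos_le_cutTime g hn hg hc p
  have hsmall : ∀ w : E, G w w < (ε / 2) ^ 2 → w ∈ S := by
    intro w hw
    by_cases hw0 : w = 0
    · subst hw0
      exact zero_mem_injectivityDomain hg p
    have hww : 0 < G w w := hg p (show TangentSpace I p from w) hw0
    set c : ℝ := Real.sqrt (G w w) with hc_def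
    have hcpos : 0 < c := Real.sqrt_pos.2 hww
    have hcsq : c * c = G w w := Real.mul_self_sqrt hww.le
    have hcε : c < ε / 2 := by
      have h1 : c * c < (ε / 2) ^ 2 := by rw [hcsq]; exact hw
      nlinarith
    set u : E := c⁻¹ • w with hu_def
    have hcu : c • u = w := by rw [hu_def, smul_inv_smul₀ hcpos.ne']
    have hu1 : G u u = 1 := by
      have h1 : G u u = c⁻¹ * c⁻¹ * G w w := by
        rw [hu_def]
        simp only [map_smul, FunLike.coe_smul, Pi.smul_apply, smul_eq_mul]
        ring
      rw [h1, ← hcsq]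
      field_simp
    have hmin : IsMinimizingUpTo g hg p (show TangentSpace I p from u) (c * 2) :=
      (hεcut u hu1).1 (c * 2) (by positivity) (by linarith)
    refine ⟨2, one_lt_two, ?_⟩
    show IsMinimizingUpTo g hg p (show TangentSpace I p from w) 2
    rw [← hcu]
    exact (isMinimizingUpTo_smul_iff hg hc p (show TangentSpace I p from u) hcpos 2).2 hmin
  rw [← isClosed_compl_iff]
  refine IsSeqClosed.isClosed fun v v₀ hv hvt ↦ ?_
  intro hv₀S
  have hfar : ∀ k, (ε / 2) ^ 2 ≤ G (v k) (v k) := fun k ↦ not_lt.1 fun h ↦ hv k (hsmall _ h)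
  have hG0 : (ε / 2) ^ 2 ≤ G v₀ v₀ :=
    ge_of_tendsto ((hGcont.tendsto v₀).comp hvt) (Eventually.of_forall hfar)
  have hε2 : 0 < (ε / 2) ^ 2 := by positivity
  have hGv₀ : 0 < G v₀ v₀ := hε2.trans_le hG0
  have hGvk : ∀ k, 0 < G (v k) (v k) := fun k ↦ hε2.trans_le (hfar k)
  set c : ℕ → ℝ := fun k ↦ Real.sqrt (G (v k) (v k)) with hc_def
  set c₀ : ℝ := Real.sqrt (G v₀ v₀) with hc₀_def
  have hc₀pos : 0 < c₀ := Real.sqrt_pos.2 hGv₀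
  have hckpos : ∀ k, 0 < c k := fun k ↦ Real.sqrt_pos.2 (hGvk k)
  have hct : Tendsto c atTop (𝓝 c₀) :=
    ((Real.continuous_sqrt.comp hGcont).tendsto v₀).comp hvt
  set u : ℕ → E := fun k ↦ (c k)⁻¹ • v k with hu_def
  set u₀ : E := c₀⁻¹ • v₀ with hu₀_def
  have hunit : ∀ (w : E) (a : ℝ), 0 < G w w → a = Real.sqrt (G w w) →
      G (a⁻¹ • w) (a⁻¹ • w) = 1 := by
    intro w a hw ha
    have hapos : 0 < a := by rw [ha]; exact Real.sqrt_pos.2 hw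
    have hasq : a * a = G w w := by rw [ha]; exact Real.mul_self_sqrt hw.le
    have h1 : G (a⁻¹ • w) (a⁻¹ • w) = a⁻¹ * a⁻¹ * G w w := by
      simp only [map_smul, FunLike.coe_smul, Pi.smul_apply, smul_eq_mul]
      ring
    rw [h1, ← hasq]
    field_simp
  have hu1 : ∀ k, G (u k) (u k) = 1 := fun k ↦ hunit (v k) (c k) (hGvk k) rfl
  have hu₀1 : G u₀ u₀ = 1 := hunit v₀ c₀ hGv₀ rfl
  have hcu : ∀ k, c k • u k = v k := fun k ↦ by
    show c k • ((c k)⁻¹ • v k) = v k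
    rw [smul_inv_smul₀ (hckpos k).ne']
  have hcu₀ : c₀ • u₀ = v₀ := by
    show c₀ • (c₀⁻¹ • v₀) = v₀
    rw [smul_inv_smul₀ hc₀pos.ne']
  have hut : Tendsto u atTop (𝓝 u₀) := (hct.inv₀ hc₀pos.ne').smul hvt
  have hcutle : ∀ k, cutTime g hg p (show TangentSpace I p from u k) ≤ ENNReal.ofReal (c k) := by
    intro k
    refine cutTime_le_ofReal_of_forall_not_isMinimizingUpTo g hg p (hckpos k).le
      fun b hb hmin ↦ ?_
    refine hv k ⟨b / c k, (one_lt_div (hckpos k)).2 hb, ?_⟩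
    have h := (isMinimizingUpTo_smul_iff hg hc p (show TangentSpace I p from u k) (hckpos k)
      (b / c k)).2 (by rw [mul_div_cancel₀ b (hckpos k).ne']; exact hmin)
    have key : ∀ w w' : E, w = w' →
        IsMinimizingUpTo g hg p (show TangentSpace I p from w) (b / c k) →
        IsMinimizingUpTo g hg p (show TangentSpace I p from w') (b / c k) := by
      rintro w w' rfl h'
      exact h'
    exact key _ _ (hcu k) h
  have hcutge : ∀ k, ENNReal.ofReal ε ≤ cutTime g hg p (show TangentSpace I p from u k) :=
    fun k ↦ (hεcut (u k) (hu1 k)).2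
  have hfin : ∀ k, cutTime g hg p (show TangentSpace I p from u k) ≠ ⊤ :=
    fun k ↦ ne_top_of_le_ne_top ENNReal.ofReal_ne_top (hcutle k)
  set t : ℕ → ℝ := fun k ↦ (cutTime g hg p (show TangentSpace I p from u k)).toReal with ht_def
  have htcut : ∀ k, cutTime g hg p (show TangentSpace I p from u k) = ENNReal.ofReal (t k) :=
    fun k ↦ (ENNReal.ofReal_toReal (hfin k)).symm
  have htε : ∀ k, ε ≤ t k := fun k ↦ by
    have h := hcutge k
    rw [htcut k] at h
    exact (ENNReal.ofReal_le_ofReal_iff ENNReal.toReal_nonneg).1 h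
  have htc : ∀ k, t k ≤ c k := fun k ↦ by
    have h := hcutle k
    rw [htcut k] at h
    exact (ENNReal.ofReal_le_ofReal_iff (hckpos k).le).1 h
  have htpos : ∀ k, 0 < t k := fun k ↦ hε.trans_le (htε k)
  obtain ⟨R, hR⟩ := (hct.isCompact_insert_range).bddAbove
  have htR : ∀ k, t k ≤ R := fun k ↦ (htc k).trans (hR (mem_insert_of_mem _ (mem_range_self k)))
  obtain ⟨t₀, -, φ, hφ, htφ⟩ :=
    isCompact_Icc.tendsto_subseq (x := t) (s := Icc ε R) fun k ↦ ⟨htε k, htR k⟩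
  have hle : cutTime g hg p (show TangentSpace I p from u₀) ≤ ENNReal.ofReal t₀ :=
    cutTime_le_of_tendsto g hn hg hc p hID (u ∘ φ) (t ∘ φ) u₀ t₀ (fun i ↦ hu1 (φ i))
      (fun i ↦ htpos (φ i)) (fun i ↦ htcut (φ i)) (hut.comp hφ.tendsto_atTop) htφ
  have ht₀c : t₀ ≤ c₀ :=
    le_of_tendsto_of_tendsto htφ (hct.comp hφ.tendsto_atTop)
      (Eventually.of_forall fun i ↦ htc (φ i))
  obtain ⟨s, hs, hmin₀⟩ := hv₀S
  have hminu : IsMinimizingUpTo g hg p (show TangentSpace I p from u₀) (c₀ * s) := by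
    refine (isMinimizingUpTo_smul_iff hg hc p (show TangentSpace I p from u₀) hc₀pos s).1 ?_
    have key : ∀ w w' : E, w = w' →
        IsMinimizingUpTo g hg p (show TangentSpace I p from w') s →
        IsMinimizingUpTo g hg p (show TangentSpace I p from w) s := by
      rintro w w' rfl h'
      exact h'
    exact key _ _ hcu₀ hmin₀
  have h1 : ENNReal.ofReal (c₀ * s) ≤ cutTime g hg p (show TangentSpace I p from u₀) :=
    ofReal_le_cutTime_of_isMinimizingUpTo g hg p (by positivity) hminu
  have ht₀ε : ε ≤ t₀ := ge_of_tendsto htφ (Eventually.of_forall fun i ↦ htε (φ i))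
  have h2 : c₀ * s ≤ t₀ :=
    (ENNReal.ofReal_le_ofReal_iff (by linarith)).1 (h1.trans hle)
  nlinarith [hs, hc₀pos, ht₀c, h2]

/-- **Proper initial parts of minimizing segments lie in `ID(p)`** (Lee 2018, p. 310 /
Prop. 10.32: points before the cut point): if `γ_v|[0,1]` is minimizing and `0 < s < 1` then
`s v ∈ ID(p)`. [cite: LeeRiemannianManifolds2018, p. 310] -/
theorem smul_mem_injectivityDomain_of_isMinimizingUpTo_one_of_lt [Fact (1 ≤ n)] (hg : g.IsRiemannian)
    (hc : IsGeodesicallyComplete g.leviCivita) (p : M) {v : TangentSpace I p}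
    (hv : IsMinimizingUpTo g hg p v 1) {s : ℝ} (hs0 : 0 < s) (hs1 : s < 1) :
    s • v ∈ injectivityDomain g hg p := by
  refine ⟨1 / s, (one_lt_div hs0).2 hs1, ?_⟩
  rw [isMinimizingUpTo_smul_iff hg hc p v hs0 (1 / s), mul_one_div_cancel hs0.ne']
  exact hv

/-- **Polar representation of points of a complete manifold** (Hopf–Rinow, Lee 2018, Cor. 6.21,
with the length of a geodesic segment, p. 307): every `y` is `exp_q v` for a `v` with
`γ_v|[0,1]` minimizing, and then `d(q, y) = |v|_g`.
[cite: LeeRiemannianManifolds2018, Cor. 6.21 and pp. 307–308] -/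
theorem exists_isMinimizingUpTo_expMap_eq [ConnectedSpace M] (hn : (∞ : ℕ∞ω) ≤ n)
    (hg : g.IsRiemannian) (hc : IsGeodesicallyComplete g.leviCivita) (q y : M) :
    ∃ v : E, IsMinimizingUpTo g hg q (show TangentSpace I q from v) 1 ∧
      expMap g.leviCivita q (show TangentSpace I q from v) = y ∧
      g.edist hg q y = ENNReal.ofReal (Real.sqrt
        (g.val q (show TangentSpace I q from v) (show TangentSpace I q from v))) := by
  haveI : Fact (1 ≤ n) := ⟨le_trans (by exact_mod_cast le_top) hn⟩
  obtain ⟨v, hmin, hy⟩ := exists_isMinimizingUpTo_of_isGeodesicallyComplete g hn hg hc q y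
  refine ⟨v, hmin, hy, ?_⟩
  have h2 := hmin.2
  rw [length_maximalGeodesic hg hc q v 0 1, sub_zero, one_mul,
    ← expMap_eq_maximalGeodesic hc q v] at h2
  rw [← hy]
  exact h2.symm

end CompleteID

section ZeroDim

/-- A connected manifold modelled on `ℝ⁰` is a single chart domain, hence compact: there is no
connected noncompact `0`-manifold. [folklore] -/
theorem false_of_chartedSpace_euclideanSpace_fin_zero {M : Type*} [TopologicalSpace M]
    [ChartedSpace (EuclideanSpace ℝ (Fin 0)) M] [ConnectedSpace M] [NoncompactSpace M] : False := by
  haveI : Subsingleton (EuclideanSpace ℝ (Fin 0)) :=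
    Module.finrank_zero_iff.1 finrank_euclideanSpace_fin
  have hopen : ∀ x : M, IsOpen ({x} : Set M) := by
    intro x
    have h : (chartAt (EuclideanSpace ℝ (Fin 0)) x).source = {x} :=
      eq_singleton_iff_unique_mem.2 ⟨mem_chart_source _ x, fun y hy ↦
        (chartAt (EuclideanSpace ℝ (Fin 0)) x).injOn hy (mem_chart_source _ x)
          (Subsingleton.elim _ _)⟩
    rw [← h]
    exact (chartAt (EuclideanSpace ℝ (Fin 0)) x).open_source
  haveI : DiscreteTopology M := ⟨eq_bot_of_singletons_open hopen⟩
  haveI : Subsingleton M := ⟨fun a b ↦ isPreconnected_univ.subsingleton (mem_univ a) (mem_univ b)⟩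
  exact noncompact_univ M (Set.finite_univ.isCompact)

end ZeroDim

section Assembly

variable {d : ℕ} {M : Type*} [TopologicalSpace M] [ChartedSpace (EuclideanSpace ℝ (Fin d)) M]
  [IsManifold 𝓘(ℝ, EuclideanSpace ℝ (Fin d)) ∞ M] [T2Space M]
  (g : PseudoRiemannianMetric 𝓘(ℝ, EuclideanSpace ℝ (Fin d)) ∞ (EuclideanSpace ℝ (Fin d))
    (TangentSpace 𝓘(ℝ, EuclideanSpace ℝ (Fin d)) : M → Type _)) [g.HasLeviCivita]
  [CovariantDerivative.ContMDiffCovariantDerivative g.leviCivita 1]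
  [CovariantDerivative.ContMDiffCovariantDerivative g.leviCivita ∞]


omit [CovariantDerivative.ContMDiffCovariantDerivative g.leviCivita 1]
  [CovariantDerivative.ContMDiffCovariantDerivative g.leviCivita ∞] [T2Space M] [g.HasLeviCivita] in
/-- **A linear isometry `(ℝᵈ, ⟪·,·⟫) ≅ (T_qM, g_q)`** from a `g_q`-orthonormal basis
(`exists_orthonormal_basis`; O'Neill 1983, Ch. 2, Lemma 2.24). [folklore] -/
theorem exists_linearIsometry_tangentSpace (hg : g.IsRiemannian) (q : M) :
    ∃ L : (EuclideanSpace ℝ (Fin d)) ≃L[ℝ] (EuclideanSpace ℝ (Fin d)), ∀ x y : (EuclideanSpace ℝ (Fin d)), g.val q (L x) (L y) = inner ℝ x y := by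
  classical
  obtain ⟨G, hG⟩ : ∃ G : (EuclideanSpace ℝ (Fin d)) →L[ℝ] (EuclideanSpace ℝ (Fin d)) →L[ℝ] ℝ, ∀ a b, G a b = g.val q a b := ⟨g.val q, fun _ _ ↦ rfl⟩
  obtain ⟨e, he⟩ := MetricCoord.exists_orthonormal_basis (G := fun _ : (EuclideanSpace ℝ (Fin d)) ↦ G) (x := (0 : (EuclideanSpace ℝ (Fin d))))
    (fun v w ↦ by rw [hG, hG]; exact g.symm q v w)
    (fun v hv ↦ by rw [hG]; exact hg q (show TangentSpace 𝓘(ℝ, (EuclideanSpace ℝ (Fin d))) q from v) hv)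
  set e' : Module.Basis (Fin d) ℝ (EuclideanSpace ℝ (Fin d)) := e.reindex (finCongr finrank_euclideanSpace_fin) with he'_def
  have he' : ∀ i j, G (e' i) (e' j) = if i = j then 1 else 0 := by
    intro i j
    rw [he'_def, Module.Basis.reindex_apply, Module.Basis.reindex_apply, he]
    simp only [finCongr_symm, finCongr_apply, Fin.cast_inj]
  set bF : Module.Basis (Fin d) ℝ (EuclideanSpace ℝ (Fin d)) := (EuclideanSpace.basisFun (Fin d) ℝ).toBasis with hbF_def
  have hbF : ∀ i, bF i = EuclideanSpace.basisFun (Fin d) ℝ i := fun i ↦ by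
    rw [hbF_def, OrthonormalBasis.coe_toBasis]
  set L₀ : (EuclideanSpace ℝ (Fin d)) ≃ₗ[ℝ] (EuclideanSpace ℝ (Fin d)) := bF.equiv e' (Equiv.refl (Fin d)) with hL₀_def
  have hL₀ : ∀ i, L₀ (bF i) = e' i := fun i ↦ by
    rw [hL₀_def, Module.Basis.equiv_apply, Equiv.refl_apply]
  refine ⟨L₀.toContinuousLinearEquiv, ?_⟩
  -- compare the two bilinear forms on the basis `bF`
  set B₀ : LinearMap.BilinForm ℝ (EuclideanSpace ℝ (Fin d)) := LinearMap.mk₂ ℝ (fun v w ↦ G v w)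
    (fun v₁ v₂ w ↦ by simp only [map_add, FunLike.coe_add, Pi.add_apply])
    (fun a v w ↦ by simp only [map_smul, FunLike.coe_smul, Pi.smul_apply, smul_eq_mul])
    (fun v w₁ w₂ ↦ by simp only [map_add])
    (fun a v w ↦ by simp only [map_smul, smul_eq_mul]) with hB₀
  set B₁ : LinearMap.BilinForm ℝ (EuclideanSpace ℝ (Fin d)) := B₀.comp L₀.toLinearMap L₀.toLinearMap with hB₁
  have hB₁_apply : ∀ v w, B₁ v w = G (L₀ v) (L₀ w) := fun v w ↦ rfl
  set B₂ : LinearMap.BilinForm ℝ (EuclideanSpace ℝ (Fin d)) := LinearMap.mk₂ ℝ (fun v w : (EuclideanSpace ℝ (Fin d)) ↦ inner ℝ v w)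
    (fun v₁ v₂ w ↦ inner_add_left _ _ _)
    (fun a v w ↦ by rw [real_inner_smul_left, smul_eq_mul])
    (fun v w₁ w₂ ↦ inner_add_right _ _ _)
    (fun a v w ↦ by rw [real_inner_smul_right, smul_eq_mul]) with hB₂
  have hB₂_apply : ∀ v w, B₂ v w = inner ℝ v w := fun v w ↦ rfl
  have hB : B₁ = B₂ := by
    refine LinearMap.BilinForm.ext_basis bF fun i j ↦ ?_
    rw [hB₁_apply, hB₂_apply, hL₀, hL₀, he', hbF, hbF,
      orthonormal_iff_ite.1 (EuclideanSpace.basisFun (Fin d) ℝ).orthonormal i j]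
  intro x y
  have h := LinearMap.congr_fun₂ hB x y
  rw [hB₁_apply, hB₂_apply, hG] at h
  exact h

/-- **Yau's argument** (Yau 1976; in the form printed in Chow et al. 2007, Part I, proof of
Thm. 2.92, (2.118), and App. A, Cor. A.4/A.6): on a connected noncompact complete Riemannian
`d`-manifold (`d ≥ 1`) with `Ric ≥ 0`, the total Riemannian measure is infinite. With `p` fixed
and `vol M = V < ∞`, for `R ≥ 2` pick `q` with `d(p, q) = R` (connectedness and non-compactness);
then `B(p, 1) ⊆ B(q, R+1) ∖ B̄(q, R-1)`, and in `g_q`-orthonormal polar coordinates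
`x ↦ exp_q(L x)` the volume of this shell is at most `∫_{R-1 ≤ |x| < R+1} Ψ`, where `Ψ` is the
Jacobian density on the (star-shaped, open) injectivity domain and `0` outside (the area
formula `riemannianMeasure_image_eq_lintegral_of_injOn` on `ID(q)`, Hopf–Rinow minimizing
segments, and a Lebesgue-null set of cut vectors `riemannianMeasure_image_eq_zero_of_volume_eq_zero`);
`Ψ` is non-increasing along rays (`antitoneOn_jacobian_expMap_ray`, `Ric ≥ 0`), so by the
shell inequality `setLIntegral_shell_le_mul_setLIntegral_ball`,
`vol B(p,1) ≤ (((R+1)^d - (R-1)^d)/(R-1)^d) · vol B(q, R-1) ≤ C(R) V → 0`, contradicting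
`vol B(p, 1) > 0`. [cite: Yau1976, Theorem (volume growth), pp. 659–670]
[cite: ChowEtAl2007RicciFlowI, Part I, proof of Thm. 2.92, (2.118); App. A, Cor. A.4, A.6] -/
theorem riemannianMeasure_univ_eq_top_of_ricci_nonneg (hd : 0 < d) [ConnectedSpace M]
    [NoncompactSpace M] [T3Space M] [MeasurableSpace M] [BorelSpace M]
    (hg : g.IsRiemannian) (hcpt : ∀ (x : M) (r : ℝ≥0), IsCompact {y : M | g.edist hg x y ≤ r})
    (hRic : ∀ (x : M) (w : TangentSpace 𝓘(ℝ, (EuclideanSpace ℝ (Fin d))) x), 0 ≤ g.leviCivita.ricci x w w) :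
    riemannianMeasure (I := 𝓘(ℝ, (EuclideanSpace ℝ (Fin d)))) (g.toContMDiffRiemannianMetric hg) (univ : Set M) = ⊤ := by
  classical
  haveI : Nontrivial (EuclideanSpace ℝ (Fin d)) := by
    have : 0 < Module.finrank ℝ (EuclideanSpace ℝ (Fin d)) := by rw [finrank_euclideanSpace_fin]; exact hd
    exact Module.finrank_pos_iff.1 this
  haveI : Fact ((1 : ℕ∞ω) ≤ ((⊤ : ℕ∞) : ℕ∞ω)) := ⟨by exact_mod_cast le_top⟩
  have hc : IsGeodesicallyComplete g.leviCivita :=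
    (isGeodesicallyComplete_iff_isCompact_setOf_edist_le g le_rfl hg).2 hcpt
  set h := g.toContMDiffRiemannianMetric hg with hh_def
  set vol : Measure M := riemannianMeasure (I := 𝓘(ℝ, (EuclideanSpace ℝ (Fin d)))) h with hvol
  by_contra hVtop
  -- the finite distance function
  have hfin : ∀ a b : M, g.edist hg a b ≠ ⊤ := fun a b ↦ edist_ne_top hg a b
  set D : M → M → ℝ := fun a b ↦ (g.edist hg a b).toReal with hD_def
  have hD : ∀ a b, g.edist hg a b = ENNReal.ofReal (D a b) := fun a b ↦
    (ENNReal.ofReal_toReal (hfin a b)).symm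
  have D_nonneg : ∀ a b, 0 ≤ D a b := fun a b ↦ ENNReal.toReal_nonneg
  have D_comm : ∀ a b, D a b = D b a := fun a b ↦ by
    show (g.edist hg a b).toReal = (g.edist hg b a).toReal
    rw [edist_comm hg a b]
  have D_triangle : ∀ a b c, D a c ≤ D a b + D b c := fun a b c ↦ by
    have h3 := edist_triangle hg a b c
    rw [hD, hD, hD, ← ENNReal.ofReal_add (D_nonneg _ _) (D_nonneg _ _)] at h3
    exact (ENNReal.ofReal_le_ofReal_iff (add_nonneg (D_nonneg _ _) (D_nonneg _ _))).1 h3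
  have D_self : ∀ a, D a a = 0 := fun a ↦ by simp [hD_def]
  have D_cont : ∀ a, Continuous fun z ↦ D a z := fun a ↦
    ENNReal.continuousOn_toReal.comp_continuous
      ((PseudoRiemannianMetric.continuous_edist hg).comp (continuous_const.prodMk continuous_id))
      fun z ↦ hfin a z
  -- the unit ball at a base point has positive finite measure
  obtain ⟨p⟩ := (inferInstance : Nonempty M)
  set B₁ : Set M := {y | g.edist hg p y < 1} with hB₁
  haveI := isOpenPosMeasure_riemannianMeasure (I := 𝓘(ℝ, (EuclideanSpace ℝ (Fin d)))) h
  have hB₁pos : 0 < vol B₁ :=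
    (PseudoRiemannianMetric.isOpen_setOf_edist_lt hg p 1).measure_pos vol
      ⟨p, by simp⟩
  -- points at every distance from `p`
  have hfarpt : ∀ R : ℝ, 0 ≤ R → ∃ q : M, D p q = R := by
    intro R hR
    obtain ⟨y, hy⟩ : ∃ y, R < D p y := by
      by_contra hne
      push Not at hne
      refine noncompact_univ M ((hcpt p R.toNNReal).of_isClosed_subset isClosed_univ fun y _ ↦ ?_)
      show g.edist hg p y ≤ ENNReal.ofReal R
      rw [hD]
      exact ENNReal.ofReal_le_ofReal (hne y)
    have hIVT := intermediate_value_univ p y (D_cont p)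
    rw [D_self] at hIVT
    obtain ⟨q, hq⟩ := hIVT ⟨hR, hy.le⟩
    exact ⟨q, hq⟩
  -- a linear isometry at each point and the polar map
  have hstep : ∀ k : ℕ, vol B₁ ≤
      ENNReal.ofReal (((((k : ℝ) + 3) ^ d - ((k : ℝ) + 1) ^ d)) / ((k : ℝ) + 1) ^ d) * vol univ := by
    intro k
    set R : ℝ := (k : ℝ) + 2 with hR_def
    have hR1 : 0 < R - 1 := by rw [hR_def]; linarith [k.cast_nonneg (α := ℝ)]
    obtain ⟨q, hq⟩ := hfarpt R (by rw [hR_def]; positivity)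
    obtain ⟨L, hL⟩ := exists_linearIsometry_tangentSpace g hg q
    -- the polar map `Φ = exp_q ∘ L`, its Jacobian density and the injectivity domain `W`
    set Φ : (EuclideanSpace ℝ (Fin d)) → M := fun x ↦ expMap g.leviCivita q (L x) with hΦ_def
    have hΦs : ContMDiff 𝓘(ℝ, (EuclideanSpace ℝ (Fin d))) 𝓘(ℝ, (EuclideanSpace ℝ (Fin d))) 1 Φ :=
      ((contMDiff_expMap_infty hc q).of_le (by exact_mod_cast le_top)).comp
        L.toContinuousLinearMap.contDiff.contMDiff
    have hΦd : ∀ z : (EuclideanSpace ℝ (Fin d)), MDifferentiableAt 𝓘(ℝ, (EuclideanSpace ℝ (Fin d))) 𝓘(ℝ, (EuclideanSpace ℝ (Fin d))) Φ z := fun z ↦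
      (hΦs z).mdifferentiableAt one_ne_zero
    set Jac : (EuclideanSpace ℝ (Fin d)) → ℝ≥0∞ := fun z ↦ ENNReal.ofReal (Real.sqrt (Matrix.of fun i j : Fin d ↦
      h.inner (Φ z) (mfderiv 𝓘(ℝ, (EuclideanSpace ℝ (Fin d))) 𝓘(ℝ, (EuclideanSpace ℝ (Fin d))) Φ z (EuclideanSpace.single i 1))
        (mfderiv 𝓘(ℝ, (EuclideanSpace ℝ (Fin d))) 𝓘(ℝ, (EuclideanSpace ℝ (Fin d))) Φ z (EuclideanSpace.single j 1))).det) with hJac_def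
    have hJac_meas : Measurable Jac :=
      ENNReal.measurable_ofReal.comp (continuous_sqrt_det_inner_mfderiv h hΦs).measurable
    set W : Set (EuclideanSpace ℝ (Fin d)) := {x | (show TangentSpace 𝓘(ℝ, (EuclideanSpace ℝ (Fin d))) q from L x) ∈ injectivityDomain g hg q}
      with hW_def
    have hWo : IsOpen W :=
      (isOpen_injectivityDomain_of_isGeodesicallyComplete g le_rfl hg hc q).preimage
        L.continuous
    have hWm : MeasurableSet W := hWo.measurableSet
    have hstar : ∀ x ∈ W, ∀ s : ℝ, 0 < s → s ≤ 1 → s • x ∈ W := by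
      intro x hx s hs0 hs1
      show (show TangentSpace 𝓘(ℝ, (EuclideanSpace ℝ (Fin d))) q from L (s • x)) ∈ injectivityDomain g hg q
      rw [map_smul]
      exact smul_mem_injectivityDomain hg hc hx hs0.le hs1
    have hinj : InjOn Φ W := by
      intro x hx y hy hxy
      have := injOn_riemannianExpMap_injectivityDomain g le_rfl hg hc q hx hy hxy
      exact L.injective this
    -- the area formula on `W` and null images
    have harea : ∀ A : Set (EuclideanSpace ℝ (Fin d)), MeasurableSet A → A ⊆ W → vol (Φ '' A) = ∫⁻ z in A, Jac z := by
      intro A hA hAW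
      exact riemannianMeasure_image_eq_lintegral_of_injOn h hWo (fun z _ ↦ hΦd z) hinj hA hAW
    set N : Set (EuclideanSpace ℝ (Fin d)) := Wᶜ ∩ ⋂ m : ℕ, (fun x : (EuclideanSpace ℝ (Fin d)) ↦ (1 - 1 / ((m : ℝ) + 2)) • x) ⁻¹' W with hN_def
    have hNm : MeasurableSet N := measurableSet_compl_inter_iInter_preimage_smul hWo
    have hN0 : volume N = 0 :=
      volume_eq_zero_of_subsingleton_ray hd hNm fun θ _ ↦ subsingleton_ray_of_star hstar θ
    have hΦN : vol (Φ '' N) = 0 :=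
      riemannianMeasure_image_eq_zero_of_volume_eq_zero h isOpen_univ (fun z _ ↦ hΦd z)
        (subset_univ N) hN0
    -- the density `Ψ = 𝟙_W · Jac` is radially non-increasing
    set Ψ : (EuclideanSpace ℝ (Fin d)) → ℝ≥0∞ := W.indicator Jac with hΨ_def
    have hΨm : Measurable Ψ := hJac_meas.indicator hWm
    have hanti : ∀ θ : (EuclideanSpace ℝ (Fin d)), ‖θ‖ = 1 → ∀ ⦃s r : ℝ⦄, 0 < s → s ≤ r → Ψ (r • θ) ≤ Ψ (s • θ) := by
      intro θ hθ s r hs hsr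
      have hr : 0 < r := hs.trans_le hsr
      by_cases hrW : r • θ ∈ W
      · have hsW : s • θ ∈ W := by
          have : s • θ = (s / r) • (r • θ) := by rw [smul_smul, div_mul_cancel₀ s hr.ne']
          rw [this]
          exact hstar _ hrW _ (div_pos hs hr) ((div_le_one hr).2 hsr)
        rw [hΨ_def, indicator_of_mem hrW, indicator_of_mem hsW]
        obtain ⟨s', hs', hmin⟩ := hrW
        have hmin' : IsMinimizingUpTo g hg q (show TangentSpace 𝓘(ℝ, (EuclideanSpace ℝ (Fin d))) q from (L θ : (EuclideanSpace ℝ (Fin d))))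
            (r * s') := by
          refine (isMinimizingUpTo_smul_iff hg hc q _ hr s').1 ?_
          have key : ∀ w w' : (EuclideanSpace ℝ (Fin d)), w = w' →
              IsMinimizingUpTo g hg q (show TangentSpace 𝓘(ℝ, (EuclideanSpace ℝ (Fin d))) q from w) s' →
              IsMinimizingUpTo g hg q (show TangentSpace 𝓘(ℝ, (EuclideanSpace ℝ (Fin d))) q from w') s' := by
            rintro w w' rfl h'
            exact h'
          exact key _ _ (L.map_smul r θ) hmin
        have hinjt : ∀ t ∈ Ioo 0 (r * s'), Injective (mfderiv 𝓘(ℝ, (EuclideanSpace ℝ (Fin d))) 𝓘(ℝ, (EuclideanSpace ℝ (Fin d)))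
            (fun u : (EuclideanSpace ℝ (Fin d)) ↦ expMap g.leviCivita q (show TangentSpace 𝓘(ℝ, (EuclideanSpace ℝ (Fin d))) q from u))
            (t • (L θ : (EuclideanSpace ℝ (Fin d))))) := by
          intro t ht
          have hmem : (show TangentSpace 𝓘(ℝ, (EuclideanSpace ℝ (Fin d))) q from t • (L θ : (EuclideanSpace ℝ (Fin d)))) ∈
              injectivityDomain g hg q := by
            refine ⟨r * s' / t, by rw [lt_div_iff₀ ht.1, one_mul]; exact ht.2, ?_⟩
            have h3 := (isMinimizingUpTo_smul_iff hg hc q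
              (show TangentSpace 𝓘(ℝ, (EuclideanSpace ℝ (Fin d))) q from (L θ : (EuclideanSpace ℝ (Fin d)))) ht.1 (r * s' / t)).2
              (by rw [mul_div_cancel₀ _ ht.1.ne']; exact hmin')
            exact h3
          exact mfderiv_riemannianExpMap_injective_of_mem_injectivityDomain g le_rfl hg hc q hmem
        have hb : 0 < r * s' := mul_pos hr (zero_lt_one.trans hs')
        have hmono := antitoneOn_jacobian_expMap_ray g hg hc hRic q L hL θ hθ hb hinjt
        have hrb : r < r * s' := lt_mul_of_one_lt_right hr hs'
        exact ENNReal.ofReal_le_ofReal (hmono ⟨hs, hsr.trans_lt hrb⟩ ⟨hr, hrb⟩ hsr)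
      · rw [hΨ_def, indicator_of_notMem hrW]
        exact zero_le
    -- `∫_A Ψ = ∫_{W ∩ A} Jac`
    have hΨint : ∀ A : Set (EuclideanSpace ℝ (Fin d)), ∫⁻ z in A, Ψ z = ∫⁻ z in W ∩ A, Jac z := fun A ↦ by
      rw [hΨ_def, lintegral_indicator hWm, Measure.restrict_restrict hWm]
    -- the shell `S_R ∋ B₁` is covered by `Φ ((W ∪ N) ∩ A_R)`
    set A : Set (EuclideanSpace ℝ (Fin d)) := {x | R - 1 < ‖x‖ ∧ ‖x‖ < R + 1} with hA_def
    have hAm : MeasurableSet A :=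
      (measurableSet_lt measurable_const measurable_norm).inter
        (measurableSet_lt measurable_norm measurable_const)
    have hcover : B₁ ⊆ Φ '' (W ∩ A) ∪ Φ '' N := by
      intro y hy
      have hpy : D p y < 1 := by
        have := hy
        rw [hB₁, mem_setOf_eq, hD, ← ENNReal.ofReal_one,
          ENNReal.ofReal_lt_ofReal_iff_of_nonneg (D_nonneg _ _)] at this
        exact this
      have hqy1 : D q y < R + 1 := by
        have := D_triangle q p y
        rw [D_comm q p, hq] at this
        linarith
      have hqy2 : R - 1 < D q y := by
        have := D_triangle p y q
        rw [hq, D_comm y q] at this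
        linarith
      obtain ⟨v, hmin, hvy, hdist⟩ := exists_isMinimizingUpTo_expMap_eq g le_rfl hg hc q y
      set x : (EuclideanSpace ℝ (Fin d)) := L.symm v with hx_def
      have hLx : (L x : (EuclideanSpace ℝ (Fin d))) = v := L.apply_symm_apply v
      have hΦx : Φ x = y := by
        show expMap g.leviCivita q (L x) = y
        rw [hLx]
        exact hvy
      have hnx : ‖x‖ = D q y := by
        rw [norm_eq_sqrt_real_inner, ← hL x x, hLx]
        show Real.sqrt (g.val q v v) = (g.edist hg q y).toReal
        rw [hdist, ENNReal.toReal_ofReal (Real.sqrt_nonneg _)]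
      have hxA : x ∈ A := ⟨by rw [hnx]; exact hqy2, by rw [hnx]; exact hqy1⟩
      by_cases hxW : x ∈ W
      · exact Or.inl ⟨x, ⟨hxW, hxA⟩, hΦx⟩
      · refine Or.inr ⟨x, ⟨hxW, mem_iInter.2 fun m ↦ ?_⟩, hΦx⟩
        have hm2 : (0 : ℝ) < (m : ℝ) + 2 := by positivity
        have hc0 : (0 : ℝ) < 1 - 1 / ((m : ℝ) + 2) := by
          rw [sub_pos, div_lt_one hm2]; linarith
        have hc1 : 1 - 1 / ((m : ℝ) + 2) < 1 := by
          have : (0 : ℝ) < 1 / ((m : ℝ) + 2) := by positivity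
          linarith
        show (show TangentSpace 𝓘(ℝ, (EuclideanSpace ℝ (Fin d))) q from L ((1 - 1 / ((m : ℝ) + 2)) • x)) ∈
          injectivityDomain g hg q
        rw [map_smul, hLx]
        exact smul_mem_injectivityDomain_of_isMinimizingUpTo_one_of_lt g hg hc q hmin hc0 hc1
    -- the chain of inequalities
    have hshell := setLIntegral_shell_le_mul_setLIntegral_ball hd hΨm hanti hR1
      (by linarith : R - 1 ≤ R + 1)
    have hWA : W ∩ A ⊆ W := inter_subset_left
    have hAsub : A ⊆ {x : (EuclideanSpace ℝ (Fin d)) | R - 1 ≤ ‖x‖ ∧ ‖x‖ < R + 1} := fun x hx ↦ ⟨hx.1.le, hx.2⟩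
    have hR3 : R + 1 = (k : ℝ) + 3 := by rw [hR_def]; ring
    have hR1' : R - 1 = (k : ℝ) + 1 := by rw [hR_def]; ring
    calc vol B₁ ≤ vol (Φ '' (W ∩ A) ∪ Φ '' N) := measure_mono hcover
      _ ≤ vol (Φ '' (W ∩ A)) + vol (Φ '' N) := measure_union_le _ _
      _ = ∫⁻ z in W ∩ A, Jac z := by rw [hΦN, add_zero, harea _ (hWm.inter hAm) hWA]
      _ = ∫⁻ z in A, Ψ z := (hΨint A).symm
      _ ≤ ∫⁻ z in {x : (EuclideanSpace ℝ (Fin d)) | R - 1 ≤ ‖x‖ ∧ ‖x‖ < R + 1}, Ψ z := lintegral_mono_set hAsub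
      _ ≤ ENNReal.ofReal (((R + 1) ^ d - (R - 1) ^ d) / (R - 1) ^ d) *
            ∫⁻ z in Metric.ball (0 : (EuclideanSpace ℝ (Fin d))) (R - 1), Ψ z := hshell
      _ = ENNReal.ofReal (((R + 1) ^ d - (R - 1) ^ d) / (R - 1) ^ d) *
            vol (Φ '' (W ∩ Metric.ball (0 : (EuclideanSpace ℝ (Fin d))) (R - 1))) := by
          rw [hΨint, harea _ (hWm.inter measurableSet_ball) inter_subset_left]
      _ ≤ ENNReal.ofReal ((((k : ℝ) + 3) ^ d - ((k : ℝ) + 1) ^ d) / ((k : ℝ) + 1) ^ d) *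
            vol univ := by
          rw [hR3, hR1']
          exact mul_le_mul' le_rfl (measure_mono (subset_univ _))
  -- the constants tend to `0`, so `vol B₁ = 0`: contradiction
  have hlim : Tendsto (fun k : ℕ ↦
      ENNReal.ofReal ((((k : ℝ) + 3) ^ d - ((k : ℝ) + 1) ^ d) / ((k : ℝ) + 1) ^ d) * vol univ)
      atTop (𝓝 0) := by
    have h1 : Tendsto (fun k : ℕ ↦ (1 : ℝ) / ((k : ℝ) + 1)) atTop (𝓝 0) :=
      tendsto_one_div_add_atTop_nhds_zero_nat
    have h2 : Tendsto (fun k : ℕ ↦ ((1 : ℝ) + 2 * (1 / ((k : ℝ) + 1))) ^ d - 1) atTop (𝓝 0) := by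
      have := (((h1.const_mul 2).const_add 1).pow d).sub_const 1
      simpa using this
    have hfeq : ∀ k : ℕ, (((k : ℝ) + 3) ^ d - ((k : ℝ) + 1) ^ d) / ((k : ℝ) + 1) ^ d =
        ((1 : ℝ) + 2 * (1 / ((k : ℝ) + 1))) ^ d - 1 := by
      intro k
      have hk : (k : ℝ) + 1 ≠ 0 := by positivity
      rw [show (1 : ℝ) + 2 * (1 / ((k : ℝ) + 1)) = ((k : ℝ) + 3) / ((k : ℝ) + 1) by
        field_simp; ring, div_pow, sub_div, div_self (pow_ne_zero _ hk)]
    have h3 : Tendsto (fun k : ℕ ↦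
        ENNReal.ofReal ((((k : ℝ) + 3) ^ d - ((k : ℝ) + 1) ^ d) / ((k : ℝ) + 1) ^ d))
        atTop (𝓝 0) := by
      have := ENNReal.tendsto_ofReal h2
      rw [ENNReal.ofReal_zero] at this
      exact this.congr fun k ↦ by rw [hfeq]
    have h4 := ENNReal.Tendsto.mul_const h3 (Or.inr hVtop)
    rwa [zero_mul] at h4
  have hB₁zero : vol B₁ ≤ 0 := ge_of_tendsto' hlim hstep
  exact absurd (le_antisymm hB₁zero zero_le) hB₁pos.ne'

end Assembly

/-- **Calabi–Yau: complete connected noncompact Riemannian manifolds with `Ric ≥ 0` have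
infinite volume** — discharge of the named fact `ricciNonneg_infiniteVolume`
(`RicciNonnegInfiniteVolume.lean`) by Yau's argument
(`riemannianMeasure_univ_eq_top_of_ricci_nonneg`; dimension `0` is vacuous:
`false_of_chartedSpace_euclideanSpace_fin_zero`).
[cite: Yau1976, Theorem (volume growth), pp. 659–670]
[cite: ChowEtAl2007RicciFlowI, Part I, proof of Thm. 2.92, (2.118); App. A, Cor. A.6] -/
theorem ricciNonneg_infiniteVolume_holds : ricciNonneg_infiniteVolume := by
  intro n M _ _ _ _ _ _ _ _ _ _ g _ hg hcpt hRic
  rcases Nat.eq_zero_or_pos n with hn | hn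
  · subst hn
    exact (false_of_chartedSpace_euclideanSpace_fin_zero (M := M)).elim
  have hk1 : ((1 : ℕ∞) : ℕ∞ω) + 1 ≤ ((⊤ : ℕ∞) : ℕ∞ω) := by
    rw [show ((1 : ℕ∞) : ℕ∞ω) + 1 = 2 by norm_num]
    exact WithTop.coe_le_coe.2 le_top
  haveI : CovariantDerivative.ContMDiffCovariantDerivative g.leviCivita 1 :=
    ⟨g.isLocallyContMDiff_leviCivita_holds 1 hk1 univ isOpen_univ⟩
  haveI : CovariantDerivative.ContMDiffCovariantDerivative g.leviCivita ((⊤ : ℕ∞) : ℕ∞ω) :=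
    ⟨g.isLocallyContMDiff_leviCivita_holds ⊤ (le_of_eq rfl) univ isOpen_univ⟩
  rw [riemVolume_eq hg]
  exact riemannianMeasure_univ_eq_top_of_ricci_nonneg g hn hg hcpt hRic

end Literature.Geometry.Riemannian
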